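import Literature.Probability.RandomPlanarGeometry.HexSAWSurfaceWallRenewalSlackTwoClassification
import HarnessLib

/-!
# Irreducible positive wall bridges at slack four: the bump-then-hairpin block (the order `D U D D U U`), and two orders that never occur

[cite: MadrasSlade1993, Section 4.2, Definition 4.2.1 (irreducible bridges, p. 90) and the remark before (4.2.21) (p. 94); Section 1.2,
Definition 1.2.4 (bridges, p. 11)] [cite: Kesten1963SAW, Section 4 (irreducible bridges)]
[cite: EntingJensen2009, Section 7.4.2, Fig. 7.10 (brickwork form of the honeycomb lattice)]
[cite: BeatonBousquetMelouDeGierDuminilCopinGuttmann2014, Section 3.1 (arXiv v5 p. 8: surface visits)]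

Lane module (pub-sawmu, wall-renewal line; successor of `…SlackFourTwoDown`). At SLACK FOUR (`n = 6k + 4`, `k` surface visits) an
irreducible positive wall bridge has two, three or four down steps. This module treats the three-down-step blocks whose vertical
profile has the Dyck order `D U D D U U` — a shallow first body `D … U` followed by a second body `D D U U`. At slack two this order is
impossible (`dudduu_false` of `…SlackTwoClassification`); at slack four it is realised by EXACTLY ONE block for every `k ≥ 2`,
the bump-then-hairpin block

  `B_k = R D R R U R^{2k−2} D L^{2k−3} D R^{2k−2} U R U R`   (`X_n = 2k + 4`, down steps at the times `1, 2k+3, 4k+1`).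

* §1 the block `g3b k` as a `Tab.walk`: membership in `ipwb (6k+4)`, `k` visits, its down-step set;
* §2 the run analysis of the order `D U D D U U` at slack four (`dudduu4_runs`: the first body is a bump `D R^{w} U` going right, the
  interior wall run goes right, the final wall run goes right, the visit count), the exit column (`dudduu4_exit`: `X_n = 2k+4`, the bump
  has width two and the last up step lands in the column of the second dive), the first dive is at column `1` (`dudduu4_head`), and the
  second body is the hairpin `D L^{2k−3} D R^{2k−2} U R U` (`dudduu4_table`);
* §3 the classification `dudduu_slack_four`: a block of `ipwb (6k+4)` with `k` visits, three down steps and the order `D U D D U U`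
  IS `g3b k`;
* §4 `dududu_false_of_mem_ipwb`: three separate bumps (`D U D U D U`) never occur in an irreducible bridge of ANY length — the slack-two
  lemmas `dududu_head` / `dududu_false` verbatim, without their (unused) length, visit and row hypotheses;
* §5 `dduudu_false_of_mem_ipwb` (OURS): a depth-two excursion followed by a bump (`D D U U D U`) never occurs in an irreducible bridge of
  ANY length — a renewal argument (the wall site one step before the bump's dive is a wall-renewal time), replacing the slack-two count
  argument of `dduudu_false`;
* §6 the dispatcher `three_down_mixed_slack_four`: with three down steps at slack four and an order other than `D D D U U U`, either the
  order is `D D U D U U` (left to the successor car; the lane's exhaustive enumeration finds no such block at slack four, `k ≤ 15`) or the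
  walk is `g3b k`.

All statements are over the lane's objects `ipwb`, `visits`, `stepsD`, `stepsU` (`…HexSAWSurfaceWallRenewal`); the general-length
tools `profile_of_card_stepsD_eq_three`, `run_const_velocity`, `eq_tab_walk_of_forall`, `mem_ipwb_of_facts_wit` are reused from the
slack-two modules, and the slack-four numerics from `…SixStepRigid` (`two_mul_visits_add_two_le_apply`,
`apply_add_card_stepsD_add_four_mul_visits_le`).

STATUS: lane theorem of the a-idea-1 bridge/renewal lineage (cars 71 `…SixStep`, 73 `…SixStepRigid`, 74a `…SlackTwoFamilies`,
74b `…SecondGap` / `…SlackTwoClassification`, 77 `…SlackFourTwoDown`); second stratum of the slack-four census `N_{3k+2,k}` («car 79a»).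
OURS (new in writing, modest): the block `g3b k`, the classification of the order `D U D D U U` at slack four, the impossibility of
`D D U U D U` at every length by a renewal argument, and the dispatcher; checked against the lane's complete enumeration of the
irreducible positive wall bridges of length `6k + 4` with `k` visits for `2 ≤ k ≤ 15` (`11, 33, 95, …, 88 645` blocks: exactly one of
order `D U D D U U` for every `k`, equal to `g3b k`; none of order `D D U D U U`) and of lengths `6k + 6` (`k ≤ 8`) and `6k + 8`
(`k ≤ 7`) (no block of order `D U D U D U` or `D D U U D U` among the `451 892` enumerated blocks).  The printed sources carry the
renewal / irreducible-bridge structure (Madras–Slade §1.2, Definition 1.2.4 (bridges, p. 11); §4.2, Definition 4.2.1 (irreducible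
bridges, p. 90) and the remark before (4.2.21), p. 94; Kesten), the brickwork frame of the honeycomb lattice (Enting–Jensen §7.4.2,
Fig. 7.10) and the surface-visit statistic (Beaton et al. §3.1) — none states the block, the classification or the two exclusions.
No budget options: every declaration elaborates within 100 000 heartbeats on the reference farm.
-/

namespace Literature.Probability.RandomPlanarGeometry.SAW.HexBW.Wall

open Finset Filter Function
open Literature.Probability.LatticeModels Literature.Probability.Percolation SimpleGraph

variable {n : ℕ} {ω : ℕ → Site 2}

/-! ### §0  Two private tools -/

/-- The Boolean adjacency test `Eight.adjE` read as a proposition. [cite: EntingJensen2009, §7.4.2, Fig. 7.10 (brickwork form of the honeycomb lattice)] -/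
private theorem adjE_iff_bh {a b c d : ℤ} : Eight.adjE a b c d = true ↔
    ((c = a + 1 ∨ a = c + 1) ∧ d = b) ∨ (c = a ∧ ((d = b + 1 ∧ (a + b) % 2 = 0) ∨ (b = d + 1 ∧ (c + d) % 2 = 0))) := by
  simp [Eight.adjE]

/-- A site of `Site 2` is determined by its two coordinates. [folklore] -/
private theorem site_ext_bh {p q : Site 2} (h0 : p 0 = q 0) (h1 : p 1 = q 1) : p = q := by
  ext i; fin_cases i; exacts [h0, h1]

/-! ### §1  The bump-then-hairpin block `R D R R U R^{2k−2} D L^{2k−3} D R^{2k−2} U R U R` (`k ≥ 2`), `X_n = 2k + 4` -/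

/-- Column table of the bump-then-hairpin block (`k ≥ 2`, length `6k+4`): `(t,0)` for `t ≤ 1`; the bump `(t−1,−1)`, `2 ≤ t ≤ 4`; the wall run
`(t−2,0)`, `5 ≤ t ≤ 2k+3`; the return run `(4k+5−t,−1)` back to column `4`; the bottom run `(t+2−4k,−2)` out to column `2k+2`; `(t+1−4k,−1)`
for `t ∈ {6k+1, 6k+2}`; the last two sites `(2k+3,0)`, `(2k+4,0)`. [cite: EntingJensen2009, §7.4.2, Fig. 7.10 (brickwork form of the honeycomb lattice)] -/
def g3bX (k t : ℕ) : ℤ :=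
  if t ≤ 1 then (t : ℤ)
  else if t ≤ 4 then (t : ℤ) - 1
  else if t ≤ 2 * k + 3 then (t : ℤ) - 2
  else if t ≤ 4 * k + 1 then 4 * (k : ℤ) + 5 - t
  else if t ≤ 6 * k then (t : ℤ) + 2 - 4 * k
  else if t ≤ 6 * k + 2 then (t : ℤ) + 1 - 4 * k
  else (t : ℤ) - 4 * k

/-- Height table of the bump-then-hairpin block. [cite: EntingJensen2009, §7.4.2, Fig. 7.10] -/
def g3bY (k t : ℕ) : ℤ :=
  if t ≤ 1 then 0
  else if t ≤ 4 then -1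
  else if t ≤ 2 * k + 3 then 0
  else if t ≤ 4 * k + 1 then -1
  else if t ≤ 6 * k then -2
  else if t ≤ 6 * k + 2 then -1
  else 0

/-- **The bump-then-hairpin block** `(0,0)→(1,0)↓(1,−1)→(2,−1)→(3,−1)↑(3,0)→…→(2k+1,0)↓←…←(4,−1)↓(4,−2)→…→(2k+2,−2)↑(2k+2,−1)→(2k+3,−1)↑
(2k+3,0)→(2k+4,0)` of length `6k+4`. [cite: EntingJensen2009, §7.4.2, Fig. 7.10] -/
def g3b (k : ℕ) : ℕ → Site 2 := Tab.walk (6 * k + 4) (g3bX k) (g3bY k)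

/-- The seven affine pieces of the tables, with their values. [cite: EntingJensen2009, §7.4.2, Fig. 7.10] -/
private theorem g3b_cases (k t : ℕ) :
    (t ≤ 1 ∧ g3bX k t = (t : ℤ) ∧ g3bY k t = 0) ∨
      (2 ≤ t ∧ t ≤ 4 ∧ g3bX k t = (t : ℤ) - 1 ∧ g3bY k t = -1) ∨
      (5 ≤ t ∧ t ≤ 2 * k + 3 ∧ g3bX k t = (t : ℤ) - 2 ∧ g3bY k t = 0) ∨
      (2 * k + 4 ≤ t ∧ t ≤ 4 * k + 1 ∧ g3bX k t = 4 * (k : ℤ) + 5 - t ∧ g3bY k t = -1) ∨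
      (4 * k + 2 ≤ t ∧ t ≤ 6 * k ∧ g3bX k t = (t : ℤ) + 2 - 4 * k ∧ g3bY k t = -2) ∨
      (6 * k + 1 ≤ t ∧ t ≤ 6 * k + 2 ∧ g3bX k t = (t : ℤ) + 1 - 4 * k ∧ g3bY k t = -1) ∨
      (6 * k + 3 ≤ t ∧ g3bX k t = (t : ℤ) - 4 * k ∧ g3bY k t = 0) := by
  simp only [g3bX, g3bY]
  split_ifs <;> omega

/-- **Coordinate facts of the bump-then-hairpin block** (`k ≥ 2`). [cite: EntingJensen2009, §7.4.2, Fig. 7.10]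
[cite: MadrasSlade1993, §1.2, Definition 1.2.4 (bridges, p. 11)] -/
theorem g3b_facts {k : ℕ} (hk : 2 ≤ k) : Tab.Facts (6 * k + 4) (g3bX k) (g3bY k) := by
  refine ⟨fun t ht => ?_, fun t ht s hs hx hy => ?_, fun t ht => ?_, fun t ht => ?_, ?_, ?_, ?_, by omega, fun t ht h1 => ?_⟩
  · rw [adjE_iff_bh]
    rcases g3b_cases k t with ⟨h, x, y⟩ | ⟨l, h, x, y⟩ | ⟨l, h, x, y⟩ | ⟨l, h, x, y⟩ | ⟨l, h, x, y⟩ | ⟨l, h, x, y⟩ | ⟨l, x, y⟩ <;>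
      rcases g3b_cases k (t + 1) with ⟨h', x', y'⟩ | ⟨l', h', x', y'⟩ | ⟨l', h', x', y'⟩ | ⟨l', h', x', y'⟩ | ⟨l', h', x', y'⟩ |
          ⟨l', h', x', y'⟩ | ⟨l', x', y'⟩ <;>
        omega
  · rcases g3b_cases k t with ⟨h, x, y⟩ | ⟨l, h, x, y⟩ | ⟨l, h, x, y⟩ | ⟨l, h, x, y⟩ | ⟨l, h, x, y⟩ | ⟨l, h, x, y⟩ | ⟨l, x, y⟩ <;>
      rcases g3b_cases k s with ⟨h', x', y'⟩ | ⟨l', h', x', y'⟩ | ⟨l', h', x', y'⟩ | ⟨l', h', x', y'⟩ | ⟨l', h', x', y'⟩ |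
          ⟨l', h', x', y'⟩ | ⟨l', x', y'⟩ <;>
        omega
  · rcases g3b_cases k t with ⟨h, x, y⟩ | ⟨l, h, x, y⟩ | ⟨l, h, x, y⟩ | ⟨l, h, x, y⟩ | ⟨l, h, x, y⟩ | ⟨l, h, x, y⟩ | ⟨l, x, y⟩ <;>
      omega
  · have h0 := g3b_cases k 0
    have hL := g3b_cases k (6 * k + 4)
    rcases g3b_cases k t with ⟨h, x, y⟩ | ⟨l, h, x, y⟩ | ⟨l, h, x, y⟩ | ⟨l, h, x, y⟩ | ⟨l, h, x, y⟩ | ⟨l, h, x, y⟩ | ⟨l, x, y⟩ <;>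
      omega
  · have h0 := g3b_cases k 0; omega
  · have h0 := g3b_cases k 0; omega
  · have hL := g3b_cases k (6 * k + 4); omega
  · rcases g3b_cases k t with ⟨h, x, y⟩ | ⟨l, h, x, y⟩ | ⟨l, h, x, y⟩ | ⟨l, h, x, y⟩ | ⟨l, h, x, y⟩ | ⟨l, h, x, y⟩ | ⟨l, x, y⟩ <;>
      omega

/-- The bump-then-hairpin block is a positive wall bridge of length `m = 6k + 4`. [cite: MadrasSlade1993, §1.2, Definition 1.2.4 (p. 11)]
[cite: EntingJensen2009, §7.4.2, Fig. 7.10] -/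
theorem g3b_mem_pwb {k m : ℕ} (hk : 2 ≤ k) (hm : m = 6 * k + 4) : g3b k ∈ pwb m :=
  mem_pwb_of_facts rfl (g3b_facts hk) hm

/-- Coordinates of the bump-then-hairpin block up to its length. [cite: EntingJensen2009, §7.4.2, Fig. 7.10] -/
theorem g3b_apply {k t : ℕ} (ht : t ≤ 6 * k + 4) : g3b k t 0 = g3bX k t ∧ g3b k t 1 = g3bY k t :=
  tab_walk_apply ht

/-- **The bump-then-hairpin block is irreducible**: its interior visits (the even times `6 ≤ t ≤ 2k+2` of the wall run, columns `4 … 2k`)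
are followed by the return to column `4` at the time `4k + 1`. [cite: MadrasSlade1993, §4.2, Definition 4.2.1 (p. 90)] [cite: Kesten1963SAW, §4]
[cite: EntingJensen2009, §7.4.2, Fig. 7.10] -/
theorem g3b_mem_ipwb {k m : ℕ} (hk : 2 ≤ k) (hm : m = 6 * k + 4) : g3b k ∈ ipwb m := by
  refine mem_ipwb_of_facts_wit rfl (g3b_facts hk) hm (by omega) fun t ht1 ht2 hte hY => ?_
  rcases g3b_cases k t with ⟨h, x, y⟩ | ⟨l, h, x, y⟩ | ⟨l, h, x, y⟩ | ⟨l, h, x, y⟩ | ⟨l, h, x, y⟩ | ⟨l, h, x, y⟩ | ⟨l, x, y⟩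
  · omega
  · omega
  · refine Or.inl ⟨4 * k + 1, by omega, by omega, ?_⟩
    rcases g3b_cases k (4 * k + 1) with ⟨h', x', y'⟩ | ⟨l', h', x', y'⟩ | ⟨l', h', x', y'⟩ | ⟨l', h', x', y'⟩ | ⟨l', h', x', y'⟩ |
        ⟨l', h', x', y'⟩ | ⟨l', x', y'⟩ <;>
      omega
  · omega
  · omega
  · omega
  · omega

/-- **The bump-then-hairpin block has `k` visits**: `k − 1` on the wall run (columns `4, 6, …, 2k`) and the endpoint.
[cite: BeatonBousquetMelouDeGierDuminilCopinGuttmann2014, §3.1 (arXiv v5 p. 8)] [cite: EntingJensen2009, §7.4.2, Fig. 7.10] -/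
theorem visits_g3b {k m : ℕ} (hk : 2 ≤ k) (hm : m = 6 * k + 4) : visits m (g3b k) = k := by
  have hY : ∀ t, t ≤ 6 * k + 4 → g3b k t 1 = g3bY k t := fun t ht => (g3b_apply ht).2
  have h1 : visits (0 + 4) (g3b k) = visits 0 (g3b k) :=
    visits_add_eq_left fun q hq1 hq2 h => by
      obtain ⟨hq0, h0⟩ := h
      rw [hY _ (by omega)] at h0
      rcases g3b_cases k (0 + q) with ⟨h', x', y'⟩ | ⟨l', h', x', y'⟩ | ⟨l', h', x', y'⟩ | ⟨l', h', x', y'⟩ | ⟨l', h', x', y'⟩ |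
          ⟨l', h', x', y'⟩ | ⟨l', x', y'⟩ <;>
        omega
  have h2 : visits (4 + (2 * k - 1)) (g3b k) = visits 4 (g3b k) + ((4 + (2 * k - 1)) / 2 - 4 / 2) :=
    visits_add_of_wall fun q _ hq => by
      rw [hY _ (by omega)]
      rcases g3b_cases k (4 + q) with ⟨h', x', y'⟩ | ⟨l', h', x', y'⟩ | ⟨l', h', x', y'⟩ | ⟨l', h', x', y'⟩ | ⟨l', h', x', y'⟩ |
          ⟨l', h', x', y'⟩ | ⟨l', x', y'⟩ <;>
        omega
  have h3 : visits (2 * k + 3 + (4 * k - 1)) (g3b k) = visits (2 * k + 3) (g3b k) :=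
    visits_add_eq_left fun q hq1 hq2 h => by
      obtain ⟨-, h0⟩ := h
      rw [hY _ (by omega)] at h0
      rcases g3b_cases k (2 * k + 3 + q) with ⟨h', x', y'⟩ | ⟨l', h', x', y'⟩ | ⟨l', h', x', y'⟩ | ⟨l', h', x', y'⟩ |
          ⟨l', h', x', y'⟩ | ⟨l', h', x', y'⟩ | ⟨l', x', y'⟩ <;>
        omega
  have h4 : visits (6 * k + 2 + 2) (g3b k) = visits (6 * k + 2) (g3b k) + ((6 * k + 2 + 2) / 2 - (6 * k + 2) / 2) :=
    visits_add_of_wall fun q _ hq => by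
      rw [hY _ (by omega)]
      rcases g3b_cases k (6 * k + 2 + q) with ⟨h', x', y'⟩ | ⟨l', h', x', y'⟩ | ⟨l', h', x', y'⟩ | ⟨l', h', x', y'⟩ |
          ⟨l', h', x', y'⟩ | ⟨l', h', x', y'⟩ | ⟨l', x', y'⟩ <;>
        omega
  rw [zero_add, visits_zero] at h1
  rw [show 4 + (2 * k - 1) = 2 * k + 3 by omega, h1] at h2
  rw [show 2 * k + 3 + (4 * k - 1) = 6 * k + 2 by omega, h2] at h3
  rw [h3] at h4
  subst hm
  rw [h4]
  omega

/-- **The bump-then-hairpin block has three down steps**, at the times `1`, `2k + 3` and `4k + 1`. [cite: EntingJensen2009, §7.4.2, Fig. 7.10] -/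
theorem stepsD_g3b {k m : ℕ} (hk : 2 ≤ k) (hm : m = 6 * k + 4) : stepsD m (g3b k) = {1, 2 * k + 3, 4 * k + 1} := by
  subst hm
  ext t
  simp only [stepsD, mem_filter, mem_range, mem_insert, mem_singleton]
  constructor
  · rintro ⟨ht, hx, hy⟩
    rw [(g3b_apply (t := t + 1) (by omega)).1, (g3b_apply (t := t) (by omega)).1] at hx
    rw [(g3b_apply (t := t + 1) (by omega)).2, (g3b_apply (t := t) (by omega)).2] at hy
    rcases g3b_cases k t with ⟨h, x, y⟩ | ⟨l, h, x, y⟩ | ⟨l, h, x, y⟩ | ⟨l, h, x, y⟩ | ⟨l, h, x, y⟩ | ⟨l, h, x, y⟩ | ⟨l, x, y⟩ <;>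
      rcases g3b_cases k (t + 1) with ⟨h', x', y'⟩ | ⟨l', h', x', y'⟩ | ⟨l', h', x', y'⟩ | ⟨l', h', x', y'⟩ | ⟨l', h', x', y'⟩ |
          ⟨l', h', x', y'⟩ | ⟨l', x', y'⟩ <;>
        omega
  · intro ht
    have ht4 : t + 1 ≤ 6 * k + 4 := by omega
    refine ⟨by omega, ?_, ?_⟩
    · rw [(g3b_apply ht4).1, (g3b_apply (t := t) (by omega)).1]
      rcases g3b_cases k t with ⟨h, x, y⟩ | ⟨l, h, x, y⟩ | ⟨l, h, x, y⟩ | ⟨l, h, x, y⟩ | ⟨l, h, x, y⟩ | ⟨l, h, x, y⟩ | ⟨l, x, y⟩ <;>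
        rcases g3b_cases k (t + 1) with ⟨h', x', y'⟩ | ⟨l', h', x', y'⟩ | ⟨l', h', x', y'⟩ | ⟨l', h', x', y'⟩ | ⟨l', h', x', y'⟩ |
            ⟨l', h', x', y'⟩ | ⟨l', x', y'⟩ <;>
          omega
    · rw [(g3b_apply ht4).2, (g3b_apply (t := t) (by omega)).2]
      rcases g3b_cases k t with ⟨h, x, y⟩ | ⟨l, h, x, y⟩ | ⟨l, h, x, y⟩ | ⟨l, h, x, y⟩ | ⟨l, h, x, y⟩ | ⟨l, h, x, y⟩ | ⟨l, x, y⟩ <;>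
        rcases g3b_cases k (t + 1) with ⟨h', x', y'⟩ | ⟨l', h', x', y'⟩ | ⟨l', h', x', y'⟩ | ⟨l', h', x', y'⟩ | ⟨l', h', x', y'⟩ |
            ⟨l', h', x', y'⟩ | ⟨l', x', y'⟩ <;>
          omega

/-- **The bump-then-hairpin block has three up steps**, at the times `4`, `6k` and `6k + 2`. [cite: EntingJensen2009, §7.4.2, Fig. 7.10] -/
theorem stepsU_g3b {k m : ℕ} (hk : 2 ≤ k) (hm : m = 6 * k + 4) : stepsU m (g3b k) = {4, 6 * k, 6 * k + 2} := by
  subst hm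
  ext t
  simp only [stepsU, mem_filter, mem_range, mem_insert, mem_singleton]
  constructor
  · rintro ⟨ht, hx, hy⟩
    rw [(g3b_apply (t := t + 1) (by omega)).1, (g3b_apply (t := t) (by omega)).1] at hx
    rw [(g3b_apply (t := t + 1) (by omega)).2, (g3b_apply (t := t) (by omega)).2] at hy
    rcases g3b_cases k t with ⟨h, x, y⟩ | ⟨l, h, x, y⟩ | ⟨l, h, x, y⟩ | ⟨l, h, x, y⟩ | ⟨l, h, x, y⟩ | ⟨l, h, x, y⟩ | ⟨l, x, y⟩ <;>
      rcases g3b_cases k (t + 1) with ⟨h', x', y'⟩ | ⟨l', h', x', y'⟩ | ⟨l', h', x', y'⟩ | ⟨l', h', x', y'⟩ | ⟨l', h', x', y'⟩ |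
          ⟨l', h', x', y'⟩ | ⟨l', x', y'⟩ <;>
        omega
  · intro ht
    have ht4 : t + 1 ≤ 6 * k + 4 := by omega
    refine ⟨by omega, ?_, ?_⟩
    · rw [(g3b_apply ht4).1, (g3b_apply (t := t) (by omega)).1]
      rcases g3b_cases k t with ⟨h, x, y⟩ | ⟨l, h, x, y⟩ | ⟨l, h, x, y⟩ | ⟨l, h, x, y⟩ | ⟨l, h, x, y⟩ | ⟨l, h, x, y⟩ | ⟨l, x, y⟩ <;>
        rcases g3b_cases k (t + 1) with ⟨h', x', y'⟩ | ⟨l', h', x', y'⟩ | ⟨l', h', x', y'⟩ | ⟨l', h', x', y'⟩ | ⟨l', h', x', y'⟩ |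
            ⟨l', h', x', y'⟩ | ⟨l', x', y'⟩ <;>
          omega
    · rw [(g3b_apply ht4).2, (g3b_apply (t := t) (by omega)).2]
      rcases g3b_cases k t with ⟨h, x, y⟩ | ⟨l, h, x, y⟩ | ⟨l, h, x, y⟩ | ⟨l, h, x, y⟩ | ⟨l, h, x, y⟩ | ⟨l, h, x, y⟩ | ⟨l, x, y⟩ <;>
        rcases g3b_cases k (t + 1) with ⟨h', x', y'⟩ | ⟨l', h', x', y'⟩ | ⟨l', h', x', y'⟩ | ⟨l', h', x', y'⟩ | ⟨l', h', x', y'⟩ |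
            ⟨l', h', x', y'⟩ | ⟨l', x', y'⟩ <;>
          omega

/-! ### §2  The order `D U D D U U`: runs, exit column, first dive, the second body -/

/-- **The runs of a `D U D D U U` block** (any length `m`; down steps `p₁ < p₂ < p₃`, up steps `r₁ < r₂ < r₃`, `r₁ < p₂`, `p₃ < r₂`): the first
body is a bump going RIGHT on row `−1` (`ω i = (i−1, −1)` for `p₁ < i ≤ r₁`, else its up step would land on the initial wall run), the interior
wall run goes RIGHT (`ω i = (i−2, 0)` for `r₁ < i ≤ p₂`, with `p₂ ≥ r₁ + 3`; a left run would put the second dive on the bump or cross `ω p₁`),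
the three runs of the second body have constant velocities `e₃, e₄, e₅ = ±1` on the rows `−1, −2, −1`, the final wall run goes right, and the
visit count is `⌊p₁/2⌋ + ⌊(p₂ − r₁)/2⌋ + ⌊(m − r₃)/2⌋`. (The slack-two proof `dudduu_false`, verbatim up to its numerics.)
[cite: MadrasSlade1993, §4.2, Definition 4.2.1 (p. 90); §1.2, Definition 1.2.4 (p. 11)] [cite: EntingJensen2009, §7.4.2, Fig. 7.10] -/
theorem dudduu4_runs {m : ℕ} (hω : ω ∈ ipwb m)
    {p₁ p₂ p₃ r₁ r₂ r₃ : ℕ} (hD : stepsD m ω = {p₁, p₂, p₃}) (hU : stepsU m ω = {r₁, r₂, r₃}) (h12 : p₁ < p₂)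
    (h23 : p₂ < p₃) (hr12 : r₁ < r₂) (hr23 : r₂ < r₃) (h1 : p₁ < r₁) (h3 : p₃ < r₃)
    (hp1 : 1 ≤ p₁) (hR0 : ∀ i, i ≤ p₁ → ω i 0 = i ∧ ω i 1 = 0)
    (hP1x : ω (p₁ + 1) 0 = p₁) (hP1y : ω (p₁ + 1) 1 = -1)
    (hhor : ∀ i, i < m → i ∉ stepsD m ω → i ∉ stepsU m ω →
      ω (i + 1) 1 = ω i 1 ∧ (ω (i + 1) 0 = ω i 0 + 1 ∨ ω (i + 1) 0 = ω i 0 - 1))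
    (ho1 : r₁ < p₂) (ho2 : p₃ < r₂) :
    ∃ e₃ e₄ e₅ : ℤ, (e₃ = 1 ∨ e₃ = -1) ∧ (e₄ = 1 ∨ e₄ = -1) ∧ (e₅ = 1 ∨ e₅ = -1) ∧ p₁ + 2 ≤ r₁ ∧ r₃ < m ∧
      (ω r₂ 0 + ω r₂ 1) % 2 = 0 ∧
      (∀ i, p₁ + 1 ≤ i → i ≤ r₁ → ω i 0 = (i : ℤ) - 1 ∧ ω i 1 = -1) ∧ r₁ % 2 = 0 ∧
      (∀ i, r₁ + 1 ≤ i → i ≤ p₂ → ω i 0 = (i : ℤ) - 2 ∧ ω i 1 = 0) ∧ r₁ + 3 ≤ p₂ ∧ p₂ % 2 = 1 ∧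
      (∀ i, p₂ + 1 ≤ i → i ≤ p₃ → ω i 0 = (p₂ : ℤ) - 2 + e₃ * ((i - (p₂ + 1) : ℕ) : ℤ) ∧ ω i 1 = -1) ∧
      ω (p₃ + 1) 0 = ω p₃ 0 ∧
      (∀ i, p₃ + 1 ≤ i → i ≤ r₂ → ω i 0 = ω (p₃ + 1) 0 + e₄ * ((i - (p₃ + 1) : ℕ) : ℤ) ∧ ω i 1 = -2) ∧
      ω (r₂ + 1) 0 = ω r₂ 0 ∧
      (∀ i, r₂ + 1 ≤ i → i ≤ r₃ → ω i 0 = ω (r₂ + 1) 0 + e₅ * ((i - (r₂ + 1) : ℕ) : ℤ) ∧ ω i 1 = -1) ∧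
      ω (r₃ + 1) 0 = ω r₃ 0 ∧ r₃ % 2 = 0 ∧
      (∀ i, r₃ + 1 ≤ i → i ≤ m → ω i 0 = ω (r₃ + 1) 0 + ((i - (r₃ + 1) : ℕ) : ℤ) ∧ ω i 1 = 0) ∧
      visits m ω = p₁ / 2 + (p₂ - r₁) / 2 + (m - r₃) / 2 := by
  classical
  obtain ⟨hp, hn1, hirr⟩ := mem_ipwb.1 hω
  obtain ⟨hw, hb⟩ := mem_pwb.1 hp
  obtain ⟨ha, -⟩ := mem_wbr.1 hw
  obtain ⟨hh, hn2, -⟩ := mem_archs.1 ha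
  obtain ⟨hs, hhp⟩ := mem_hpw.1 hh
  obtain ⟨h0, -, hbw, hinj⟩ := mem_saws_iff.1 hs
  have hX0 : ω 0 0 = 0 := by rw [h0]; rfl
  have hb' : ∀ i, 1 ≤ i → i ≤ m → 0 < ω i 0 ∧ ω i 0 ≤ ω m 0 := fun i h1 h2 => by
    have := hb i h1 h2; rwa [hX0] at this
  have hmD : ∀ i, i ∈ stepsD m ω ↔ i = p₁ ∨ i = p₂ ∨ i = p₃ := fun i => by
    rw [hD]; simp only [Finset.mem_insert, Finset.mem_singleton]
  have hmU : ∀ i, i ∈ stepsU m ω ↔ i = r₁ ∨ i = r₂ ∨ i = r₃ := fun i => by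
    rw [hU]; simp only [Finset.mem_insert, Finset.mem_singleton]
  obtain ⟨hqn, hqx, hqy, hqpar⟩ := of_mem_stepsD_coord hbw (i := p₂) ((hmD _).2 (by simp))
  obtain ⟨hq3n, hq3x, hq3y, -⟩ := of_mem_stepsD_coord hbw (i := p₃) ((hmD _).2 (by simp))
  obtain ⟨hrn, hrx, hry, hrpar⟩ := of_mem_stepsU_coord hbw (i := r₁) ((hmU _).2 (by simp))
  obtain ⟨hsn, hsx, hsy, hspar⟩ := of_mem_stepsU_coord hbw (i := r₂) ((hmU _).2 (by simp))
  obtain ⟨hr3n, hr3x, hr3y, hr3par⟩ := of_mem_stepsU_coord hbw (i := r₃) ((hmU _).2 (by simp))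
  have hhor' : ∀ i, i < m → i ≠ p₁ → i ≠ p₂ → i ≠ p₃ → i ≠ r₁ → i ≠ r₂ → i ≠ r₃ →
      ω (i + 1) 1 = ω i 1 ∧ (ω (i + 1) 0 = ω i 0 + 1 ∨ ω (i + 1) 0 = ω i 0 - 1) :=
    fun i hi n1 n2 n3 n4 n5 n6 => hhor i hi (by rw [hmD]; omega) (by rw [hmU]; omega)
  have hmem : ∀ i, i ≤ m → i ∈ {i | i ≤ m} := fun i hi => hi
  -- run 1 on row `−1` goes right and the first up step returns to the wall at column `r₁ − 1`
  obtain ⟨e1, he1, hrun1⟩ := run_const_velocity hinj (a := p₁ + 1) (b := r₁) (by omega) (by omega)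
    (fun i hi1 hi2 => hhor' i (by omega) (by omega) (by omega) (by omega) (by omega) (by omega) (by omega))
  have hx : (p₁ : ℤ) + 1 ≤ ω r₁ 0 := by
    by_contra hlt
    have hr1 := (hb' r₁ (by omega) (by omega)).1
    have hτ := hR0 (ω r₁ 0).toNat (by omega)
    have := hinj (hmem (r₁ + 1) (by omega)) (hmem (ω r₁ 0).toNat (by omega))
      (site_ext_bh (by rw [hrx, hτ.1]; omega) (by rw [hry, (hrun1 r₁ (by omega) le_rfl).2, hP1y, hτ.2]; rfl))
    omega
  obtain rfl : e1 = 1 := by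
    rcases he1 with h | rfl
    · exact h
    exfalso; have := (hrun1 r₁ (by omega) le_rfl).1; rw [hP1x] at this; omega
  have hR1x : ω (r₁ + 1) 0 = r₁ - 1 := by
    have := (hrun1 r₁ (by omega) le_rfl).1; rw [hP1x] at this; rw [hrx]; omega
  have hR1y : ω (r₁ + 1) 1 = 0 := by rw [hry, (hrun1 r₁ (by omega) le_rfl).2, hP1y]; rfl
  have hrev : r₁ % 2 = 0 := by
    have h1 := (hrun1 r₁ (by omega) le_rfl).1; have h2 := (hrun1 r₁ (by omega) le_rfl).2
    rw [hP1x] at h1; rw [hP1y] at h2; rw [h1, h2] at hrpar; omega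
  -- run 2 on the wall goes right (else the second down step lands on run 1, or the run crosses `ω p₁`)
  obtain ⟨e2, he2, hrun2⟩ := run_const_velocity hinj (a := r₁ + 1) (b := p₂) (by omega) (by omega)
    (fun i hi1 hi2 => hhor' i (by omega) (by omega) (by omega) (by omega) (by omega) (by omega) (by omega))
  have hq2 : r₁ + 2 ≤ p₂ := by
    by_contra h
    obtain rfl : p₂ = r₁ + 1 := by omega
    have := hinj (hmem (r₁ + 1 + 1) (by omega)) (hmem r₁ (by omega))
      (site_ext_bh (by rw [hqx, hR1x, (hrun1 r₁ (by omega) le_rfl).1, hP1x]; omega)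
        (by rw [hqy, hR1y, (hrun1 r₁ (by omega) le_rfl).2, hP1y]; rfl))
    omega
  obtain rfl : e2 = 1 := by
    rcases he2 with h | rfl
    · exact h
    exfalso
    have hQx := (hrun2 p₂ (by omega) le_rfl).1
    have hQy := (hrun2 p₂ (by omega) le_rfl).2
    rw [hR1x] at hQx; rw [hR1y] at hQy
    by_cases hc : p₁ + p₂ ≤ 2 * r₁
    · have h1 := hrun1 (2 * r₁ - p₂ + 1) (by omega) (by omega)
      rw [hP1x, hP1y] at h1
      have := hinj (hmem (p₂ + 1) (by omega)) (hmem (2 * r₁ - p₂ + 1) (by omega))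
        (site_ext_bh (by rw [hqx, hQx, h1.1]; omega) (by rw [hqy, hQy, h1.2]; rfl))
      omega
    · have h1 := hrun2 (2 * r₁ - p₁) (by omega) (by omega)
      rw [hR1x, hR1y] at h1
      have h2 := hR0 p₁ le_rfl
      have := hinj (hmem (2 * r₁ - p₁) (by omega)) (hmem p₁ (by omega))
        (site_ext_bh (by rw [h1.1, h2.1]; omega) (by rw [h1.2, h2.2]))
      omega
  have hQ1x : ω (p₂ + 1) 0 = p₂ - 2 := by
    rw [hqx, (hrun2 p₂ (by omega) le_rfl).1, hR1x]; omega
  have hQ1y : ω (p₂ + 1) 1 = -1 := by rw [hqy, (hrun2 p₂ (by omega) le_rfl).2, hR1y]; rfl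
  have hq3 : r₁ + 3 ≤ p₂ := by rw [hQ1x, hQ1y] at hqpar; omega
  have hpar2 : p₂ % 2 = 1 := by
    have := parity_apply hs (show p₂ + 1 ≤ m by omega); rw [hQ1x, hQ1y] at this; omega
  -- heights after the second down step: row `−1` until `p₃`, row `−2` until `r₂`, row `−1` until `r₃`, then the wall
  obtain ⟨e3, he3, hrun3⟩ := run_const_velocity hinj (a := p₂ + 1) (b := p₃) (by omega) (by omega)
    (fun i hi1 hi2 => hhor' i (by omega) (by omega) (by omega) (by omega) (by omega) (by omega) (by omega))
  have hC1y : ω (p₃ + 1) 1 = -2 := by rw [hq3y, (hrun3 p₃ (by omega) le_rfl).2, hQ1y]; rfl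
  obtain ⟨e4, he4, hrun4⟩ := run_const_velocity hinj (a := p₃ + 1) (b := r₂) (by omega) (by omega)
    (fun i hi1 hi2 => hhor' i (by omega) (by omega) (by omega) (by omega) (by omega) (by omega) (by omega))
  have hD1y : ω (r₂ + 1) 1 = -1 := by rw [hsy, (hrun4 r₂ (by omega) le_rfl).2, hC1y]; rfl
  obtain ⟨e5, he5, hrun5⟩ := run_const_velocity hinj (a := r₂ + 1) (b := r₃) (by omega) (by omega)
    (fun i hi1 hi2 => hhor' i (by omega) (by omega) (by omega) (by omega) (by omega) (by omega) (by omega))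
  have hSy : ω r₃ 1 = -1 := by rw [(hrun5 r₃ (by omega) le_rfl).2, hD1y]
  have hS1y : ω (r₃ + 1) 1 = 0 := by rw [hr3y, hSy]; rfl
  have hsev : r₃ % 2 = 0 := by have := parity_apply hs (show r₃ ≤ m by omega); rw [hSy] at this; omega
  -- the final wall run goes right
  obtain ⟨e6, he6, hrun6⟩ := run_const_velocity hinj (a := r₃ + 1) (b := m) (by omega) le_rfl
    (fun i hi1 hi2 => hhor' i (by omega) (by omega) (by omega) (by omega) (by omega) (by omega) (by omega))
  obtain rfl : e6 = 1 := by
    rcases he6 with h | rfl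
    · exact h
    exfalso
    have hN := (hrun6 m (by omega) le_rfl).1
    have hbn := (hb' (r₃ + 1) (by omega) (by omega)).2
    omega
  -- the visit count: initial wall run, interior wall run `r₁+1 … p₂`, final wall run
  have hvf : visits m ω = p₁ / 2 + (p₂ - r₁) / 2 + (m - r₃) / 2 := by
    have hv1 : visits p₁ ω = p₁ / 2 := visits_eq_div_two_of_wall (fun i _ hi2 => (hR0 i hi2).2)
    have hv2 : visits r₁ ω = visits p₁ ω := by
      have := visits_add_eq_left (k := p₁) (b := r₁ - p₁) (ζ := ω) (fun j hj1 hj2 => ?_)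
      · rwa [show p₁ + (r₁ - p₁) = r₁ by omega] at this
      rintro ⟨-, hy⟩
      have := (hrun1 (p₁ + j) (by omega) (by omega)).2; rw [hP1y] at this; omega
    have hv3 : visits m ω = visits r₁ ω + visits (m - r₁) (fun j => ω (r₁ + j)) := by
      have := visits_add (a := r₁) (b := m - r₁) (ζ := ω) (ξ := fun j => ω (r₁ + j)) hrev (fun j _ _ => rfl)
      rwa [show r₁ + (m - r₁) = m by omega] at this
    have hv4 : visits (p₂ - r₁) (fun j => ω (r₁ + j)) = (p₂ - r₁) / 2 :=
      visits_eq_div_two_of_wall (fun i hi1 hi2 => by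
        show ω (r₁ + i) 1 = 0
        rw [(hrun2 (r₁ + i) (by omega) (by omega)).2, hR1y])
    have hv5 : visits (r₃ - r₁) (fun j => ω (r₁ + j)) = visits (p₂ - r₁) (fun j => ω (r₁ + j)) := by
      have := visits_add_eq_left (k := p₂ - r₁) (b := r₃ - p₂) (ζ := fun j => ω (r₁ + j)) (fun j hj1 hj2 => ?_)
      · rwa [show p₂ - r₁ + (r₃ - p₂) = r₃ - r₁ by omega] at this
      rintro ⟨-, hy⟩
      have hy : ω (r₁ + (p₂ - r₁ + j)) 1 = 0 := hy
      rw [show r₁ + (p₂ - r₁ + j) = p₂ + j by omega] at hy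
      rcases Nat.lt_or_ge (p₂ + j) (p₃ + 1) with hj | hj
      · have := (hrun3 (p₂ + j) (by omega) (by omega)).2; rw [hQ1y] at this; omega
      rcases Nat.lt_or_ge (p₂ + j) (r₂ + 1) with hja | hja
      · have := (hrun4 (p₂ + j) hj (by omega)).2; rw [hC1y] at this; omega
      · have := (hrun5 (p₂ + j) hja (by omega)).2; rw [hD1y] at this; omega
    have hv6 : visits (m - r₁) (fun j => ω (r₁ + j)) =
        visits (r₃ - r₁) (fun j => ω (r₁ + j)) + visits (m - r₃) (fun _ => (0 : Site 2)) := by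
      have := visits_add (a := r₃ - r₁) (b := m - r₃) (ζ := fun j => ω (r₁ + j)) (ξ := fun _ => (0 : Site 2))
        (by omega) (fun j hj1 hj2 => ?_)
      · rwa [show r₃ - r₁ + (m - r₃) = m - r₁ by omega] at this
      show ω (r₁ + (r₃ - r₁ + j)) 1 = (0 : Site 2) 1
      rw [show r₁ + (r₃ - r₁ + j) = r₃ + j by omega, (hrun6 (r₃ + j) (by omega) (by omega)).2, hS1y]; rfl
    have hv7 : visits (m - r₃) (fun _ => (0 : Site 2)) = (m - r₃) / 2 := visits_eq_div_two_of_wall (fun i _ _ => rfl)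
    rw [hv3, hv2, hv1, hv6, hv5, hv4, hv7]; omega
  have hpr : p₁ + 2 ≤ r₁ := by
    have := (hrun1 r₁ (by omega) le_rfl).1; rw [hP1x] at this; push_cast [show p₁ + 1 ≤ r₁ by omega] at this; omega
  refine ⟨e3, e4, e5, he3, he4, he5, hpr, hr3n, hspar, fun i hi1 hi2 => ?_, hrev, fun i hi1 hi2 => ?_, hq3, hpar2,
    fun i hi1 hi2 => ?_, hq3x, fun i hi1 hi2 => ?_, hsx, fun i hi1 hi2 => ?_, hr3x, hsev, fun i hi1 hi2 => ?_, hvf⟩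
  · have := hrun1 i hi1 hi2; rw [hP1x, hP1y] at this; push_cast [show p₁ + 1 ≤ i from hi1] at this; omega
  · have := hrun2 i hi1 hi2; rw [hR1x, hR1y] at this; push_cast [show r₁ + 1 ≤ i from hi1] at this; omega
  · have := hrun3 i hi1 hi2; rw [hQ1x, hQ1y] at this; exact this
  · have := hrun4 i hi1 hi2; rw [hC1y] at this; exact this
  · have := hrun5 i hi1 hi2; rw [hD1y] at this; exact this
  · have := hrun6 i hi1 hi2; rw [hS1y] at this; simpa using this

/-- **The exit column of a `D U D D U U` block at slack four** (`m = 6k+4`, `k` visits): the gap and charge counts of `…SixStepRigid` give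
`X_m ∈ {2k+2, 2k+4}`; the visit count gives the landing column `x₅ = X_m − 2k − 1 + p₁ + p₂ − r₁` of the last up step; that wall site is fresh,
hence not on the initial wall run (`x₅ > p₁`), not above the bump (`x₅ ≥ r₁ − 1`, else the last up step starts ON the bump) and not on the
interior wall run (`x₅ ≥ p₂ − 1`): so `X_m = 2k + 4`, the bump has width two (`r₁ = p₁ + 3`), `x₅ = p₂`, and the final wall run has
`2k + 4 − p₂` steps. (At slack two the same three exclusions leave nothing: `dudduu_false`.)
[cite: MadrasSlade1993, §4.2, remark before (4.2.21) (p. 94); §1.2, Definition 1.2.4 (p. 11)] [cite: EntingJensen2009, §7.4.2, Fig. 7.10] -/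
theorem dudduu4_exit {k m p₁ p₂ p₃ r₁ r₂ r₃ : ℕ} {e₅ : ℤ} (hk : 2 ≤ k) (hm : m = 6 * k + 4) (hω : ω ∈ ipwb m)
    (hv : visits m ω = k) (hD : stepsD m ω = {p₁, p₂, p₃}) (h12 : p₁ < p₂) (h23 : p₂ < p₃) (ho2 : p₃ < r₂) (hr23 : r₂ < r₃)
    (hr3 : r₃ < m) (hpodd : p₁ % 2 = 1) (hrev : r₁ % 2 = 0) (hpar2 : p₂ % 2 = 1) (hsev : r₃ % 2 = 0) (hpr : p₁ + 2 ≤ r₁)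
    (hq3 : r₁ + 3 ≤ p₂) (hR0 : ∀ i, i ≤ p₁ → ω i 0 = i ∧ ω i 1 = 0)
    (hR1 : ∀ i, p₁ + 1 ≤ i → i ≤ r₁ → ω i 0 = (i : ℤ) - 1 ∧ ω i 1 = -1)
    (hR2 : ∀ i, r₁ + 1 ≤ i → i ≤ p₂ → ω i 0 = (i : ℤ) - 2 ∧ ω i 1 = 0)
    (hR5 : ∀ i, r₂ + 1 ≤ i → i ≤ r₃ → ω i 0 = ω (r₂ + 1) 0 + e₅ * ((i - (r₂ + 1) : ℕ) : ℤ) ∧ ω i 1 = -1)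
    (hSx : ω (r₃ + 1) 0 = ω r₃ 0)
    (hR6 : ∀ i, r₃ + 1 ≤ i → i ≤ m → ω i 0 = ω (r₃ + 1) 0 + ((i - (r₃ + 1) : ℕ) : ℤ) ∧ ω i 1 = 0)
    (hvf : visits m ω = p₁ / 2 + (p₂ - r₁) / 2 + (m - r₃) / 2) :
    ω m 0 = 2 * k + 4 ∧ r₁ = p₁ + 3 ∧ ω (r₃ + 1) 0 = p₂ ∧ r₃ + 2 * k + 5 = m + p₂ := by
  classical
  obtain ⟨hp, -, -⟩ := mem_ipwb.1 hω
  obtain ⟨-, hb⟩ := mem_pwb.1 hp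
  have hs : ω ∈ saws m := saws_of_mem_pwb hp
  obtain ⟨h0, -, -, hinj⟩ := mem_saws_iff.1 hs
  have hX0 : ω 0 0 = 0 := by rw [h0]; rfl
  have hb' : ∀ i, 1 ≤ i → i ≤ m → 0 < ω i 0 ∧ ω i 0 ≤ ω m 0 := fun i h1 h2 => by
    have := hb i h1 h2; rwa [hX0] at this
  have hmem : ∀ i, i ≤ m → i ∈ {i | i ≤ m} := fun i hi => hi
  have hcard : #(stepsD m ω) = 3 := by
    rw [hD, Finset.card_insert_of_notMem (by simp; omega), Finset.card_insert_of_notMem (by simp; omega),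
      Finset.card_singleton]
  have hG := two_mul_visits_add_two_le_apply hω (by omega)
  have hC := apply_add_card_stepsD_add_four_mul_visits_le hω (by omega)
  rw [hv] at hG hC
  rw [hcard] at hC
  have hN := hR6 m (by omega) le_rfl
  have hpm := parity_apply hs (le_refl m)
  rw [hN.2] at hpm
  rw [hvf] at hv
  have hS1y : ω (r₃ + 1) 1 = 0 := (hR6 (r₃ + 1) le_rfl (by omega)).2
  have hSy : ω r₃ 1 = -1 := (hR5 r₃ (by omega) le_rfl).2
  -- the landing site `(x₅, 0)` of the last up step is fresh
  have hx1 : (p₁ : ℤ) + 1 ≤ ω (r₃ + 1) 0 := by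
    by_contra hlt
    have h1 := (hb' (r₃ + 1) (by omega) (by omega)).1
    have hτ := hR0 (ω (r₃ + 1) 0).toNat (by omega)
    have := hinj (hmem (r₃ + 1) (by omega)) (hmem (ω (r₃ + 1) 0).toNat (by omega))
      (site_ext_bh (by rw [hτ.1]; omega) (by rw [hS1y, hτ.2]))
    omega
  have hx2 : (r₁ : ℤ) - 1 ≤ ω (r₃ + 1) 0 := by
    by_contra hlt
    have h1 := hR1 ((ω (r₃ + 1) 0).toNat + 1) (by omega) (by omega)
    have := hinj (hmem r₃ (by omega)) (hmem ((ω (r₃ + 1) 0).toNat + 1) (by omega))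
      (site_ext_bh (by rw [h1.1, ← hSx]; omega) (by rw [hSy, h1.2]))
    omega
  have hx3 : (p₂ : ℤ) - 1 ≤ ω (r₃ + 1) 0 := by
    by_contra hlt
    have h1 := hR2 ((ω (r₃ + 1) 0).toNat + 2) (by omega) (by omega)
    have := hinj (hmem (r₃ + 1) (by omega)) (hmem ((ω (r₃ + 1) 0).toNat + 2) (by omega))
      (site_ext_bh (by rw [h1.1]; omega) (by rw [hS1y, h1.2]))
    omega
  omega

/-- **The second body stays right of the bump**: in a `D U D D U U` block whose bump is `D R R U` at column `p₁` and whose last up step lands in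
column `p₂`, every site of the second body has column `≥ p₁ + 3` — its row-`−1` runs cannot pass the bump's sites `(p₁ … p₁+2, −1)`, and its
row-`−2` run ends where the last row-`−1` run starts. [cite: MadrasSlade1993, §1.2, Definition 1.2.4 (p. 11)] [cite: EntingJensen2009, §7.4.2, Fig. 7.10] -/
theorem dudduu4_floor {m p₁ p₂ p₃ r₂ r₃ : ℕ} {e₃ e₄ e₅ : ℤ} (hinj : Set.InjOn ω {i | i ≤ m})
    (hpos : ∀ i, 1 ≤ i → i ≤ m → 0 < ω i 0) (he₃ : e₃ = 1 ∨ e₃ = -1) (he₄ : e₄ = 1 ∨ e₄ = -1) (he₅ : e₅ = 1 ∨ e₅ = -1)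
    (h6 : p₁ + 6 ≤ p₂) (h23 : p₂ < p₃) (ho2 : p₃ < r₂) (hr23 : r₂ < r₃) (hr3 : r₃ < m)
    (hR1 : ∀ i, p₁ + 1 ≤ i → i ≤ p₁ + 3 → ω i 0 = (i : ℤ) - 1 ∧ ω i 1 = -1)
    (hR3 : ∀ i, p₂ + 1 ≤ i → i ≤ p₃ → ω i 0 = (p₂ : ℤ) - 2 + e₃ * ((i - (p₂ + 1) : ℕ) : ℤ) ∧ ω i 1 = -1)
    (hCx : ω (p₃ + 1) 0 = ω p₃ 0)
    (hR4 : ∀ i, p₃ + 1 ≤ i → i ≤ r₂ → ω i 0 = ω (p₃ + 1) 0 + e₄ * ((i - (p₃ + 1) : ℕ) : ℤ) ∧ ω i 1 = -2)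
    (hDx : ω (r₂ + 1) 0 = ω r₂ 0)
    (hR5 : ∀ i, r₂ + 1 ≤ i → i ≤ r₃ → ω i 0 = ω (r₂ + 1) 0 + e₅ * ((i - (r₂ + 1) : ℕ) : ℤ) ∧ ω i 1 = -1)
    (hx5 : ω r₃ 0 = p₂) :
    (p₁ : ℤ) + 3 ≤ ω p₃ 0 ∧ (p₁ : ℤ) + 3 ≤ ω r₂ 0 ∧ ∀ j, p₂ + 1 ≤ j → j ≤ r₃ → (p₁ : ℤ) + 3 ≤ ω j 0 := by
  have hmem : ∀ i, i ≤ m → i ∈ {i | i ≤ m} := fun i hi => hi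
  have hc3 := (hR3 p₃ (by omega) le_rfl).1
  have hc4 := (hR4 r₂ (by omega) le_rfl).1
  have hc5 := (hR5 r₃ (by omega) le_rfl).1
  rw [hx5, hDx] at hc5
  -- (A) the first row-`−1` run of the second body does not reach the bump
  have hA : (p₁ : ℤ) + 3 ≤ ω p₃ 0 := by
    rcases he₃ with rfl | rfl
    · rw [hc3]; omega
    · by_contra hlt
      have h1 := hR3 (2 * p₂ - p₁ - 3) (by omega) (by rw [hc3] at hlt; omega)
      have h2 := hR1 (p₁ + 3) (by omega) le_rfl
      have := hinj (hmem (2 * p₂ - p₁ - 3) (by omega)) (hmem (p₁ + 3) (by omega))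
        (site_ext_bh (by rw [h1.1, h2.1]; omega) (by rw [h1.2, h2.2]))
      omega
  -- (B) the row-`−2` run ends right of the bump
  have hB : (p₁ : ℤ) + 3 ≤ ω r₂ 0 := by
    by_contra hlt
    have hpos4 := hpos r₂ (by omega) (by omega)
    have hy5 := (hR5 (r₂ + 1) le_rfl (by omega)).2
    rcases lt_or_ge (ω r₂ 0) (p₁ : ℤ) with hlo | hhi
    · -- the last row-`−1` run goes right from a column `< p₁` to `p₂` and passes the bump site `(p₁, −1)`
      obtain rfl : e₅ = 1 := by
        rcases he₅ with h | rfl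
        · exact h
        · exfalso; omega
      have h1 := hR5 (r₂ + 1 + (p₁ - (ω r₂ 0).toNat)) (by omega) (by omega)
      have h2 := hR1 (p₁ + 1) le_rfl (by omega)
      have := hinj (hmem (r₂ + 1 + (p₁ - (ω r₂ 0).toNat)) (by omega)) (hmem (p₁ + 1) (by omega))
        (site_ext_bh (by rw [h1.1, h2.1, hDx]; push_cast; omega) (by rw [h1.2, h2.2]))
      omega
    · -- the up step at `r₂` lands ON the bump
      have h1 := hR1 ((ω r₂ 0).toNat + 1) (by omega) (by omega)
      have := hinj (hmem (r₂ + 1) (by omega)) (hmem ((ω r₂ 0).toNat + 1) (by omega))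
        (site_ext_bh (by rw [hDx, h1.1]; omega) (by rw [hy5, h1.2]))
      omega
  refine ⟨hA, hB, fun j hj1 hj2 => ?_⟩
  rcases Nat.lt_or_ge j (p₃ + 1) with hj3 | hj3
  · have := (hR3 j hj1 (by omega)).1
    rcases he₃ with rfl | rfl
    · omega
    · rw [hc3] at hA; omega
  rcases Nat.lt_or_ge j (r₂ + 1) with hj4 | hj4
  · have := (hR4 j hj3 (by omega)).1
    rw [hCx] at this hc4
    rcases he₄ with rfl | rfl <;> omega
  · have := (hR5 j hj4 hj2).1
    rw [hDx] at this
    rcases he₅ with rfl | rfl <;> omega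

/-- **The first dive of a `D U D D U U` block at slack four is at column `1`**: if `p₁ ≥ 3`, the visit `(2, 0)` at time `2` would be a
wall-renewal time — every later site has column `≥ 3` (the bump, the wall runs, and the second body by `dudduu4_floor`).
[cite: MadrasSlade1993, §4.2, Definition 4.2.1 (p. 90)] [cite: Kesten1963SAW, §4] -/
theorem dudduu4_head {m p₁ p₂ r₃ : ℕ} (hb : ∀ i, 1 ≤ i → i ≤ m → ω 0 0 < ω i 0 ∧ ω i 0 ≤ ω m 0)
    (hirr : ∀ t, 1 ≤ t → t < m → ¬ IsWRen m ω t) (hpodd : p₁ % 2 = 1) (h6 : p₁ + 6 ≤ p₂) (hp2 : p₂ < r₃) (hr3 : r₃ < m)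
    (hR0 : ∀ i, i ≤ p₁ → ω i 0 = i ∧ ω i 1 = 0)
    (hR1 : ∀ i, p₁ + 1 ≤ i → i ≤ p₁ + 3 → ω i 0 = (i : ℤ) - 1 ∧ ω i 1 = -1)
    (hR2 : ∀ i, p₁ + 4 ≤ i → i ≤ p₂ → ω i 0 = (i : ℤ) - 2 ∧ ω i 1 = 0)
    (hfl : ∀ j, p₂ + 1 ≤ j → j ≤ r₃ → (p₁ : ℤ) + 3 ≤ ω j 0) (hx5 : ω (r₃ + 1) 0 = p₂)
    (hR6 : ∀ i, r₃ + 1 ≤ i → i ≤ m → ω i 0 = ω (r₃ + 1) 0 + ((i - (r₃ + 1) : ℕ) : ℤ) ∧ ω i 1 = 0) :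
    p₁ = 1 := by
  by_contra hne
  refine hirr 2 (by omega) (by omega) (isWRen_of_profile hb (by omega) (by omega) (hR0 2 (by omega)).2 ?_ ?_)
  · intro i h1 h2; rw [(hR0 i (by omega)).1, (hR0 2 (by omega)).1]; omega
  · intro j h1 h2
    rw [(hR0 2 (by omega)).1]
    rcases Nat.lt_or_ge j (p₁ + 1) with hj | hj
    · rw [(hR0 j (by omega)).1]; omega
    rcases Nat.lt_or_ge j (p₁ + 4) with hj1 | hj1
    · have := (hR1 j hj (by omega)).1; omega
    rcases Nat.lt_or_ge j (p₂ + 1) with hj2 | hj2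
    · have := (hR2 j hj1 (by omega)).1; omega
    rcases Nat.lt_or_ge j (r₃ + 1) with hj3 | hj3
    · have := hfl j hj2 (by omega); omega
    · have := (hR6 j hj3 h2).1; rw [hx5] at this; omega

/-- **The second body of a `D U D D U U` block at slack four is the hairpin `D L^{2k−3} D R^{2k−2} U R U`** (first dive at column `1`, bump
`D R R U`, interior wall run `(3,0) … (p₂−2, 0)`, last up step landing in column `p₂`, `X_m = 2k+4`): the visit `(4, 0)` at time `6` is not a
wall-renewal time, so the second body returns to column `4 = p₁ + 3` (its floor, `dudduu4_floor`) — necessarily at the end of its first row-`−1`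
run (a row-`−2` return to column `4` would make the last row-`−1` run cross that first run); the row-`−2` run then goes right and must stop
just left of column `p₂` (stopping at `p₂` violates the up-step parity, stopping short of `p₂ − 1` lands the up step on the first run, passing
`p₂` gives a block of the wrong length or parity); the length count gives `p₂ = 2k + 3`.
[cite: MadrasSlade1993, §4.2, Definition 4.2.1 (p. 90); §1.2, Definition 1.2.4 (p. 11)] [cite: EntingJensen2009, §7.4.2, Fig. 7.10] -/
theorem dudduu4_table {k m p₂ p₃ r₂ r₃ : ℕ} {e₃ e₄ e₅ : ℤ} (hm : m = 6 * k + 4) (hinj : Set.InjOn ω {i | i ≤ m})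
    (hb : ∀ i, 1 ≤ i → i ≤ m → ω 0 0 < ω i 0 ∧ ω i 0 ≤ ω m 0) (h00 : ω 0 0 = 0)
    (hirr : ∀ t, 1 ≤ t → t < m → ¬ IsWRen m ω t) (he₃ : e₃ = 1 ∨ e₃ = -1) (he₄ : e₄ = 1 ∨ e₄ = -1)
    (he₅ : e₅ = 1 ∨ e₅ = -1) (h7 : 7 ≤ p₂) (hpar2 : p₂ % 2 = 1) (h23 : p₂ < p₃) (ho2 : p₃ < r₂) (hr23 : r₂ < r₃)
    (hr3 : r₃ < m) (hlen : r₃ + 2 * k + 5 = m + p₂) (hUpar : (ω r₂ 0 + ω r₂ 1) % 2 = 0)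
    (hR0 : ∀ i, i ≤ 1 → ω i 0 = i ∧ ω i 1 = 0)
    (hR1 : ∀ i, 1 + 1 ≤ i → i ≤ 1 + 3 → ω i 0 = (i : ℤ) - 1 ∧ ω i 1 = -1)
    (hR2 : ∀ i, 1 + 4 ≤ i → i ≤ p₂ → ω i 0 = (i : ℤ) - 2 ∧ ω i 1 = 0)
    (hR3 : ∀ i, p₂ + 1 ≤ i → i ≤ p₃ → ω i 0 = (p₂ : ℤ) - 2 + e₃ * ((i - (p₂ + 1) : ℕ) : ℤ) ∧ ω i 1 = -1)
    (hCx : ω (p₃ + 1) 0 = ω p₃ 0)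
    (hR4 : ∀ i, p₃ + 1 ≤ i → i ≤ r₂ → ω i 0 = ω (p₃ + 1) 0 + e₄ * ((i - (p₃ + 1) : ℕ) : ℤ) ∧ ω i 1 = -2)
    (hDx : ω (r₂ + 1) 0 = ω r₂ 0)
    (hR5 : ∀ i, r₂ + 1 ≤ i → i ≤ r₃ → ω i 0 = ω (r₂ + 1) 0 + e₅ * ((i - (r₂ + 1) : ℕ) : ℤ) ∧ ω i 1 = -1)
    (hSx : ω (r₃ + 1) 0 = ω r₃ 0) (hx5 : ω (r₃ + 1) 0 = p₂)
    (hR6 : ∀ i, r₃ + 1 ≤ i → i ≤ m → ω i 0 = ω (r₃ + 1) 0 + ((i - (r₃ + 1) : ℕ) : ℤ) ∧ ω i 1 = 0) :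
    p₂ = 2 * k + 3 ∧ e₃ = -1 ∧ p₃ = 4 * k + 1 ∧ ω (p₃ + 1) 0 = 4 ∧ e₄ = 1 ∧ r₂ = 6 * k ∧ ω (r₂ + 1) 0 = 2 * k + 2 ∧
      e₅ = 1 ∧ r₃ = 6 * k + 2 := by
  have hmem : ∀ i, i ≤ m → i ∈ {i | i ≤ m} := fun i hi => hi
  have hpos : ∀ i, 1 ≤ i → i ≤ m → 0 < ω i 0 := fun i h1 h2 => by have := (hb i h1 h2).1; rwa [h00] at this
  have hx5' : ω r₃ 0 = p₂ := by rw [← hSx, hx5]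
  obtain ⟨hA, hB, hfl⟩ := dudduu4_floor (p₁ := 1) hinj hpos he₃ he₄ he₅ (by omega) h23 ho2 hr23 hr3 hR1 hR3 hCx hR4
    hDx hR5 hx5'
  have hc3 := (hR3 p₃ (by omega) le_rfl).1
  have hc4 := (hR4 r₂ (by omega) le_rfl).1
  have hc5 := (hR5 r₃ (by omega) le_rfl).1
  rw [hx5', hDx] at hc5
  have hy4 : ω (r₂ + 1) 1 = -1 := (hR5 (r₂ + 1) le_rfl (by omega)).2
  have hq1x : ω (p₂ + 1) 0 = (p₂ : ℤ) - 2 := by have := (hR3 (p₂ + 1) le_rfl (by omega)).1; simpa using this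
  have hq1y : ω (p₂ + 1) 1 = -1 := (hR3 (p₂ + 1) le_rfl (by omega)).2
  -- the visit `(4,0)` at time `6` is shielded: a later site of column `≤ 4`, necessarily in the second body, of column exactly `4`
  have hex : ∃ j, p₂ + 1 ≤ j ∧ j ≤ r₃ ∧ ω j 0 = 4 := by
    by_contra hcon
    push Not at hcon
    refine hirr 6 (by omega) (by omega) (isWRen_of_profile hb (by omega) (by omega) (hR2 6 (by omega) (by omega)).2 ?_ ?_)
    · intro i h1 h2
      rw [(hR2 6 (by omega) (by omega)).1]
      rcases Nat.lt_or_ge i 2 with hi | hi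
      · rw [(hR0 i (by omega)).1]; omega
      rcases Nat.lt_or_ge i 5 with hi' | hi'
      · rw [(hR1 i (by omega) (by omega)).1]; omega
      · rw [(hR2 i (by omega) (by omega)).1]; omega
    · intro j h1 h2
      rw [(hR2 6 (by omega) (by omega)).1]
      rcases Nat.lt_or_ge j (p₂ + 1) with hj | hj
      · rw [(hR2 j (by omega) (by omega)).1]; omega
      rcases Nat.lt_or_ge j (r₃ + 1) with hj' | hj'
      · have h4 := hfl j hj (by omega)
        have := hcon j hj (by omega)
        omega
      · have := (hR6 j hj' h2).1; rw [hx5] at this; omega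
  -- a row-`−2` return to column `4` is impossible: the last row-`−1` run would cross the first one at `(p₂ − 2, −1)`
  have hB4 : ω r₂ 0 ≠ 4 := by
    intro h4
    obtain rfl : e₅ = 1 := by
      rcases he₅ with h | rfl
      · exact h
      · exfalso; omega
    have h1 := hR5 (r₂ + 1 + (p₂ - 6)) (by omega) (by omega)
    rw [hDx, h4] at h1
    have := hinj (hmem (r₂ + 1 + (p₂ - 6)) (by omega)) (hmem (p₂ + 1) (by omega))
      (site_ext_bh (by rw [h1.1, hq1x]; omega) (by rw [h1.2, hq1y]))
    omega
  -- hence the first row-`−1` run of the second body goes left and ends at column `4`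
  have hC4 : ω p₃ 0 = 4 := by
    obtain ⟨j, hj1, hj2, hj4⟩ := hex
    rcases Nat.lt_or_ge j (p₃ + 1) with hj3 | hj3
    · have := (hR3 j hj1 (by omega)).1
      rcases he₃ with rfl | rfl
      · omega
      · rw [hc3]; rw [hc3] at hA; omega
    rcases Nat.lt_or_ge j (r₂ + 1) with hj5 | hj5
    · have := (hR4 j hj3 (by omega)).1
      rw [hCx] at this hc4
      rcases he₄ with rfl | rfl <;> omega
    · have := (hR5 j hj5 hj2).1
      rw [hDx] at this
      rcases he₅ with rfl | rfl <;> omega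
  obtain rfl : e₃ = -1 := by
    rcases he₃ with rfl | h
    · exfalso; rw [hc3] at hC4; omega
    · exact h
  have hp3 : p₃ = 2 * p₂ - 5 := by rw [hc3] at hC4; omega
  -- the row-`−2` run goes right (a left run drops below the floor; an empty run returns to column `4`)
  have hr2 : p₃ + 2 ≤ r₂ := by
    by_contra h
    obtain rfl : r₂ = p₃ + 1 := by omega
    exact hB4 (by rw [hc4, hCx, hC4]; simp)
  obtain rfl : e₄ = 1 := by
    rcases he₄ with h | rfl
    · exact h
    · exfalso; rw [hCx, hC4] at hc4; omega
  rw [hCx, hC4] at hc4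
  -- where the row-`−2` run stops: not short of `p₂ − 1` (the up step would land on the first row-`−1` run), not at `p₂` (parity),
  -- not beyond `p₂` (length/parity): so at `p₂ − 1`, and the length count gives `p₂ = 2k + 3`
  have hD1 : (p₂ : ℤ) - 1 ≤ ω r₂ 0 := by
    by_contra hlt
    have h1 := hR3 (p₂ + 1 + (p₂ - 2 - (ω r₂ 0).toNat)) (by omega) (by omega)
    have := hinj (hmem (r₂ + 1) (by omega)) (hmem (p₂ + 1 + (p₂ - 2 - (ω r₂ 0).toNat)) (by omega))
      (site_ext_bh (by rw [hDx, h1.1]; omega) (by rw [hy4, h1.2]))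
    omega
  have hy2 : ω r₂ 1 = -2 := (hR4 r₂ (by omega) le_rfl).2
  rw [hy2] at hUpar
  refine ⟨?_, rfl, ?_, by rw [hCx, hC4], rfl, ?_, ?_, ?_, ?_⟩
  · rcases he₅ with rfl | rfl <;> omega
  · rcases he₅ with rfl | rfl <;> omega
  · rcases he₅ with rfl | rfl <;> omega
  · rcases he₅ with rfl | rfl <;> omega
  · rcases he₅ with rfl | h
    · rfl
    · exfalso; rw [h] at hc5; omega
  · rcases he₅ with rfl | rfl <;> omega

/-- **The table, first half** (times `≤ 2k + 3`): with the forced times, signs and columns, a `D U D D U U` block agrees with the tables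
`g3bX k`, `g3bY k` on the initial run, the bump and the interior wall run. [cite: EntingJensen2009, §7.4.2, Fig. 7.10] -/
theorem dudduu4_tab_lo {k p₂ : ℕ}
    (hR0 : ∀ i, i ≤ 1 → ω i 0 = i ∧ ω i 1 = 0)
    (hR1 : ∀ i, 2 ≤ i → i ≤ 4 → ω i 0 = (i : ℤ) - 1 ∧ ω i 1 = -1)
    (hR2 : ∀ i, 5 ≤ i → i ≤ p₂ → ω i 0 = (i : ℤ) - 2 ∧ ω i 1 = 0) (hp2 : p₂ = 2 * k + 3) :
    ∀ i, i ≤ 2 * k + 3 → ω i 0 = g3bX k i ∧ ω i 1 = g3bY k i := by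
  subst hp2
  intro i hi
  simp only [g3bX, g3bY]
  rcases Nat.lt_or_ge i 2 with h1 | h1
  · obtain ⟨hx, hy⟩ := hR0 i (by omega)
    rw [hx, hy]; constructor <;> split_ifs <;> omega
  rcases Nat.lt_or_ge i 5 with h2 | h2
  · obtain ⟨hx, hy⟩ := hR1 i h1 (by omega)
    rw [hx, hy]; constructor <;> split_ifs <;> omega
  · obtain ⟨hx, hy⟩ := hR2 i h2 (by omega)
    rw [hx, hy]; constructor <;> split_ifs <;> omega

/-- **The table, second half** (times `≥ 2k + 4`): the hairpin `D L^{2k−3} D R^{2k−2} U R U` and the final wall run agree with the tables.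
[cite: EntingJensen2009, §7.4.2, Fig. 7.10] -/
theorem dudduu4_tab_hi {k p₂ p₃ r₂ r₃ : ℕ} (hk : 2 ≤ k)
    (hR3 : ∀ i, p₂ + 1 ≤ i → i ≤ p₃ → ω i 0 = (p₂ : ℤ) - 2 + (-1) * ((i - (p₂ + 1) : ℕ) : ℤ) ∧ ω i 1 = -1)
    (hR4 : ∀ i, p₃ + 1 ≤ i → i ≤ r₂ → ω i 0 = 4 + 1 * ((i - (p₃ + 1) : ℕ) : ℤ) ∧ ω i 1 = -2)
    (hR5 : ∀ i, r₂ + 1 ≤ i → i ≤ r₃ → ω i 0 = 2 * (k : ℤ) + 2 + 1 * ((i - (r₂ + 1) : ℕ) : ℤ) ∧ ω i 1 = -1)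
    (hR6 : ∀ i, r₃ + 1 ≤ i → i ≤ 6 * k + 4 → ω i 0 = (p₂ : ℤ) + ((i - (r₃ + 1) : ℕ) : ℤ) ∧ ω i 1 = 0)
    (hp2 : p₂ = 2 * k + 3) (hp3 : p₃ = 4 * k + 1) (hr2 : r₂ = 6 * k) (hr3 : r₃ = 6 * k + 2) :
    ∀ i, 2 * k + 4 ≤ i → i ≤ 6 * k + 4 → ω i 0 = g3bX k i ∧ ω i 1 = g3bY k i := by
  subst hp2 hp3 hr2 hr3
  intro i hlo hi
  simp only [g3bX, g3bY]
  rcases Nat.lt_or_ge i (4 * k + 1 + 1) with h4 | h4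
  · obtain ⟨hx, hy⟩ := hR3 i (by omega) (by omega)
    rw [hx, hy]; constructor <;> split_ifs <;> omega
  rcases Nat.lt_or_ge i (6 * k + 1) with h5 | h5
  · obtain ⟨hx, hy⟩ := hR4 i h4 (by omega)
    rw [hx, hy]; constructor <;> split_ifs <;> omega
  rcases Nat.lt_or_ge i (6 * k + 2 + 1) with h6 | h6
  · obtain ⟨hx, hy⟩ := hR5 i h5 (by omega)
    rw [hx, hy]; constructor <;> split_ifs <;> omega
  · obtain ⟨hx, hy⟩ := hR6 i h6 hi
    rw [hx, hy]; constructor <;> split_ifs <;> omega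

/-! ### §3  Classification: a `D U D D U U` block at slack four is the bump-then-hairpin block -/

/-- **The order `D U D D U U` at slack four is the single block `g3b k`.** For an irreducible positive wall bridge of length `6k + 4` with `k`
visits (`k ≥ 2`) and three down steps `p₁ < p₂ < p₃`, up steps `r₁ < r₂ < r₃`, in the order `r₁ < p₂`, `p₃ < r₂` (the profile data of
`profile_of_card_stepsD_eq_three`): `p₁ = 1`, `r₁ = 4`, `p₂ = 2k+3`, `p₃ = 4k+1`, `r₂ = 6k`, `r₃ = 6k+2`, and the walk IS
`R D R R U R^{2k−2} D L^{2k−3} D R^{2k−2} U R U R`. OURS (the slack-four successor of `dudduu_false`).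
[cite: MadrasSlade1993, §4.2, Definition 4.2.1 (p. 90) and remark before (4.2.21) (p. 94)] [cite: EntingJensen2009, §7.4.2, Fig. 7.10] -/
theorem dudduu_slack_four {k m : ℕ} (hk : 2 ≤ k) (hm : m = 6 * k + 4) (hω : ω ∈ ipwb m) (hv : visits m ω = k)
    {p₁ p₂ p₃ r₁ r₂ r₃ : ℕ} (hD : stepsD m ω = {p₁, p₂, p₃}) (hU : stepsU m ω = {r₁, r₂, r₃}) (h12 : p₁ < p₂)
    (h23 : p₂ < p₃) (hr12 : r₁ < r₂) (hr23 : r₂ < r₃) (h1 : p₁ < r₁) (h3 : p₃ < r₃)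
    (hp1 : 1 ≤ p₁) (hpodd : p₁ % 2 = 1) (hR0 : ∀ i, i ≤ p₁ → ω i 0 = i ∧ ω i 1 = 0)
    (hP1x : ω (p₁ + 1) 0 = p₁) (hP1y : ω (p₁ + 1) 1 = -1)
    (hhor : ∀ i, i < m → i ∉ stepsD m ω → i ∉ stepsU m ω →
      ω (i + 1) 1 = ω i 1 ∧ (ω (i + 1) 0 = ω i 0 + 1 ∨ ω (i + 1) 0 = ω i 0 - 1))
    (ho1 : r₁ < p₂) (ho2 : p₃ < r₂) :
    p₁ = 1 ∧ r₁ = 4 ∧ p₂ = 2 * k + 3 ∧ p₃ = 4 * k + 1 ∧ r₂ = 6 * k ∧ r₃ = 6 * k + 2 ∧ ω = g3b k := by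
  classical
  obtain ⟨hp, hn1, hirr⟩ := mem_ipwb.1 hω
  obtain ⟨hw, hb⟩ := mem_pwb.1 hp
  have hs : ω ∈ saws m := saws_of_mem_pwb hp
  obtain ⟨h0, -, -, hinj⟩ := mem_saws_iff.1 hs
  have hX0 : ω 0 0 = 0 := by rw [h0]; rfl
  obtain ⟨e₃, e₄, e₅, he₃, he₄, he₅, hpr, hr3m, hUpar, hR1, hrev, hR2, hq3, hpar2, hR3, hCx, hR4, hDx, hR5, hSx, hsev,
    hR6, hvf⟩ := dudduu4_runs hω hD hU h12 h23 hr12 hr23 h1 h3 hp1 hR0 hP1x hP1y hhor ho1 ho2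
  obtain ⟨-, hr1, hx5, hlen⟩ := dudduu4_exit hk hm hω hv hD h12 h23 ho2 hr23 hr3m hpodd hrev hpar2 hsev hpr hq3 hR0
    hR1 hR2 hR5 hSx hR6 hvf
  subst hr1
  have hpos : ∀ i, 1 ≤ i → i ≤ m → 0 < ω i 0 := fun i h1 h2 => by have := (hb i h1 h2).1; rwa [hX0] at this
  have hx5' : ω r₃ 0 = p₂ := by rw [← hSx, hx5]
  obtain ⟨-, -, hfl⟩ := dudduu4_floor hinj hpos he₃ he₄ he₅ (by omega) h23 ho2 hr23 hr3m
    (fun i hi1 hi2 => hR1 i hi1 hi2) hR3 hCx hR4 hDx hR5 hx5'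
  obtain rfl := dudduu4_head hb hirr hpodd (by omega) (by omega) hr3m hR0 (fun i hi1 hi2 => hR1 i hi1 hi2)
    (fun i hi1 hi2 => hR2 i (by omega) hi2) hfl hx5 hR6
  obtain ⟨hp2, he3, hp3, hc3, he4, hr2, hc4, he5, hr3⟩ := dudduu4_table hm hinj hb hX0 hirr he₃ he₄ he₅ (by omega)
    hpar2 h23 ho2 hr23 hr3m hlen hUpar hR0 (fun i hi1 hi2 => hR1 i (by omega) (by omega))
    (fun i hi1 hi2 => hR2 i (by omega) hi2) hR3 hCx hR4 hDx hR5 hSx hx5 hR6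
  subst he3 he4 he5 hm
  have hlo := dudduu4_tab_lo hR0 (fun i hi1 hi2 => hR1 i (by omega) (by omega)) (fun i hi1 hi2 => hR2 i (by omega) hi2) hp2
  have hhi := dudduu4_tab_hi hk hR3 (fun i hi1 hi2 => ?_) (fun i hi1 hi2 => ?_) (fun i hi1 hi2 => ?_) hp2 hp3 hr2 hr3
  · refine ⟨rfl, rfl, hp2, hp3, hr2, hr3, eq_tab_walk_of_forall hs fun i hi => ?_⟩
    rcases Nat.lt_or_ge i (2 * k + 4) with h | h
    · exact hlo i (by omega)
    · exact hhi i h hi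
  · have := hR4 i hi1 hi2; rwa [hc3] at this
  · have := hR5 i hi1 hi2; rwa [hc4] at this
  · have := hR6 i hi1 hi2; rwa [hx5] at this

/-- **Corollary**: a `D U D D U U` block of `ipwb (6k+4)` with `k` visits is `g3b k` — so there is exactly one such block for every `k ≥ 2`
(membership: `g3b_mem_ipwb`, `visits_g3b`, `stepsD_g3b = {1, 2k+3, 4k+1}`, `stepsU_g3b = {4, 6k, 6k+2}`). OURS.
[cite: MadrasSlade1993, §4.2, remark before (4.2.21) (p. 94)] [cite: EntingJensen2009, §7.4.2, Fig. 7.10] -/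
theorem eq_g3b_of_dudduu {k m : ℕ} (hk : 2 ≤ k) (hm : m = 6 * k + 4) (hω : ω ∈ ipwb m) (hv : visits m ω = k)
    {p₁ p₂ p₃ r₁ r₂ r₃ : ℕ} (hD : stepsD m ω = {p₁, p₂, p₃}) (hU : stepsU m ω = {r₁, r₂, r₃}) (h12 : p₁ < p₂)
    (h23 : p₂ < p₃) (hr12 : r₁ < r₂) (hr23 : r₂ < r₃) (h1 : p₁ < r₁) (h3 : p₃ < r₃)
    (hp1 : 1 ≤ p₁) (hpodd : p₁ % 2 = 1) (hR0 : ∀ i, i ≤ p₁ → ω i 0 = i ∧ ω i 1 = 0)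
    (hP1x : ω (p₁ + 1) 0 = p₁) (hP1y : ω (p₁ + 1) 1 = -1)
    (hhor : ∀ i, i < m → i ∉ stepsD m ω → i ∉ stepsU m ω →
      ω (i + 1) 1 = ω i 1 ∧ (ω (i + 1) 0 = ω i 0 + 1 ∨ ω (i + 1) 0 = ω i 0 - 1))
    (ho1 : r₁ < p₂) (ho2 : p₃ < r₂) : ω = g3b k :=
  (dudduu_slack_four hk hm hω hv hD hU h12 h23 hr12 hr23 h1 h3 hp1 hpodd hR0 hP1x hP1y hhor ho1 ho2).2.2.2.2.2.2

/-! ### §4  The order `D U D U D U` never occurs (any length)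

The slack-two lemmas `dududu_head` / `dududu_false` of `…SlackTwoClassification` carry the hypotheses `m = 6k + 2`, `visits = k` and the
row bookkeeping `hYt` of the profile lemma, but their proofs use none of them: three separate bumps are impossible in an irreducible bridge of
ANY length (the first wall return is a wall-renewal time). We record the hypothesis-free statements (same proofs, verbatim), so that the
slack-four — and every later — classification can discharge this order by name. -/

/-- `D U D U D U`, step 1 (any length) — **the first three runs go right**: run 1 on row `−1` from the first dive, the interior wall run from the
first wall return `(r₁ − 1, 0)`, and run 3 on row `−1` from the second dive `(p₂ − 2, −1)`, up to the second wall return `(r₂ − 3, 0)`.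
The proof of `dududu_head` verbatim, without its unused length / visit / row hypotheses.
[cite: MadrasSlade1993, §4.2, Definition 4.2.1 (p. 90)] [cite: EntingJensen2009, §7.4.2, Fig. 7.10] -/
theorem dududu_head_of_mem_ipwb {m : ℕ} (hω : ω ∈ ipwb m)
    {p₁ p₂ p₃ r₁ r₂ r₃ : ℕ} (hD : stepsD m ω = {p₁, p₂, p₃}) (hU : stepsU m ω = {r₁, r₂, r₃}) (h12 : p₁ < p₂)
    (h23 : p₂ < p₃) (hr12 : r₁ < r₂) (hr23 : r₂ < r₃) (h1 : p₁ < r₁) (h2 : p₂ < r₂) (h3 : p₃ < r₃)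
    (hp1 : 1 ≤ p₁) (hpodd : p₁ % 2 = 1) (hR0 : ∀ i, i ≤ p₁ → ω i 0 = i ∧ ω i 1 = 0)
    (hP1x : ω (p₁ + 1) 0 = p₁) (hP1y : ω (p₁ + 1) 1 = -1)
    (hhor : ∀ i, i < m → i ∉ stepsD m ω → i ∉ stepsU m ω →
      ω (i + 1) 1 = ω i 1 ∧ (ω (i + 1) 0 = ω i 0 + 1 ∨ ω (i + 1) 0 = ω i 0 - 1))
    (ho1 : r₁ < p₂) (ho2 : r₂ < p₃) :
    (∀ i, p₁ + 1 ≤ i → i ≤ r₁ → ω i 0 = ω (p₁ + 1) 0 + 1 * ((i - (p₁ + 1) : ℕ) : ℤ) ∧ ω i 1 = ω (p₁ + 1) 1) ∧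
      ω (r₁ + 1) 0 = r₁ - 1 ∧ ω (r₁ + 1) 1 = 0 ∧ r₁ % 2 = 0 ∧
      (∀ i, r₁ + 1 ≤ i → i ≤ p₂ → ω i 0 = ω (r₁ + 1) 0 + 1 * ((i - (r₁ + 1) : ℕ) : ℤ) ∧ ω i 1 = ω (r₁ + 1) 1) ∧
      r₁ + 3 ≤ p₂ ∧ ω (p₂ + 1) 0 = p₂ - 2 ∧ ω (p₂ + 1) 1 = -1 ∧
      (∀ i, p₂ + 1 ≤ i → i ≤ r₂ → ω i 0 = ω (p₂ + 1) 0 + 1 * ((i - (p₂ + 1) : ℕ) : ℤ) ∧ ω i 1 = ω (p₂ + 1) 1) ∧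
      p₂ + 2 ≤ r₂ ∧ ω (r₂ + 1) 0 = r₂ - 3 ∧ ω (r₂ + 1) 1 = 0 := by
  classical
  obtain ⟨hp, hn1, hirr⟩ := mem_ipwb.1 hω
  obtain ⟨hw, hb⟩ := mem_pwb.1 hp
  obtain ⟨ha, -⟩ := mem_wbr.1 hw
  obtain ⟨hh, -, -⟩ := mem_archs.1 ha
  obtain ⟨hs, hhp⟩ := mem_hpw.1 hh
  obtain ⟨h0, -, hbw, hinj⟩ := mem_saws_iff.1 hs
  have hX0 : ω 0 0 = 0 := by rw [h0]; rfl
  have hb' : ∀ i, 1 ≤ i → i ≤ m → 0 < ω i 0 ∧ ω i 0 ≤ ω m 0 := fun i h1 h2 => by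
    have := hb i h1 h2; rwa [hX0] at this
  have hmD : ∀ i, i ∈ stepsD m ω ↔ i = p₁ ∨ i = p₂ ∨ i = p₃ := fun i => by
    rw [hD]; simp only [Finset.mem_insert, Finset.mem_singleton]
  have hmU : ∀ i, i ∈ stepsU m ω ↔ i = r₁ ∨ i = r₂ ∨ i = r₃ := fun i => by
    rw [hU]; simp only [Finset.mem_insert, Finset.mem_singleton]
  obtain ⟨hqn, hqx, hqy, hqpar⟩ := of_mem_stepsD_coord hbw (i := p₂) ((hmD _).2 (by simp))
  obtain ⟨hq3n, hq3x, hq3y, hq3par⟩ := of_mem_stepsD_coord hbw (i := p₃) ((hmD _).2 (by simp))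
  obtain ⟨hrn, hrx, hry, hrpar⟩ := of_mem_stepsU_coord hbw (i := r₁) ((hmU _).2 (by simp))
  obtain ⟨hsn, hsx, hsy, hspar⟩ := of_mem_stepsU_coord hbw (i := r₂) ((hmU _).2 (by simp))
  obtain ⟨hr3n, hr3x, hr3y, hr3par⟩ := of_mem_stepsU_coord hbw (i := r₃) ((hmU _).2 (by simp))
  have hhor' : ∀ i, i < m → i ≠ p₁ → i ≠ p₂ → i ≠ p₃ → i ≠ r₁ → i ≠ r₂ → i ≠ r₃ →
      ω (i + 1) 1 = ω i 1 ∧ (ω (i + 1) 0 = ω i 0 + 1 ∨ ω (i + 1) 0 = ω i 0 - 1) :=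
    fun i hi n1 n2 n3 n4 n5 n6 => hhor i hi (by rw [hmD]; omega) (by rw [hmU]; omega)
  have hmem : ∀ i, i ≤ m → i ∈ {i | i ≤ m} := fun i hi => hi
  -- run 1 on row `−1` goes right and the first up step returns to the wall at column `r₁ − 1`
  obtain ⟨e1, he1, hrun1⟩ := run_const_velocity hinj (a := p₁ + 1) (b := r₁) (by omega) (by omega)
    (fun i hi1 hi2 => hhor' i (by omega) (by omega) (by omega) (by omega) (by omega) (by omega) (by omega))
  have hx : (p₁ : ℤ) + 1 ≤ ω r₁ 0 := by
    by_contra hlt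
    have hr1 := (hb' r₁ (by omega) (by omega)).1
    have hτ := hR0 (ω r₁ 0).toNat (by omega)
    have := hinj (hmem (r₁ + 1) (by omega)) (hmem (ω r₁ 0).toNat (by omega))
      (site_ext_bh (by rw [hrx, hτ.1]; omega) (by rw [hry, (hrun1 r₁ (by omega) le_rfl).2, hP1y, hτ.2]; rfl))
    omega
  obtain rfl : e1 = 1 := by
    rcases he1 with h | rfl
    · exact h
    exfalso; have := (hrun1 r₁ (by omega) le_rfl).1; rw [hP1x] at this; omega
  have hR1x : ω (r₁ + 1) 0 = r₁ - 1 := by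
    have := (hrun1 r₁ (by omega) le_rfl).1; rw [hP1x] at this; rw [hrx]; omega
  have hR1y : ω (r₁ + 1) 1 = 0 := by rw [hry, (hrun1 r₁ (by omega) le_rfl).2, hP1y]; rfl
  have hrev : r₁ % 2 = 0 := by
    have h1 := (hrun1 r₁ (by omega) le_rfl).1; have h2 := (hrun1 r₁ (by omega) le_rfl).2
    rw [hP1x] at h1; rw [hP1y] at h2; rw [h1, h2] at hrpar; omega
  -- run 2 on the wall goes right (else the second down step lands on run 1, or the run crosses `ω p₁`)
  obtain ⟨e2, he2, hrun2⟩ := run_const_velocity hinj (a := r₁ + 1) (b := p₂) (by omega) (by omega)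
    (fun i hi1 hi2 => hhor' i (by omega) (by omega) (by omega) (by omega) (by omega) (by omega) (by omega))
  have hq2 : r₁ + 2 ≤ p₂ := by
    by_contra h
    obtain rfl : p₂ = r₁ + 1 := by omega
    have := hinj (hmem (r₁ + 1 + 1) (by omega)) (hmem r₁ (by omega))
      (site_ext_bh (by rw [hqx, hR1x, (hrun1 r₁ (by omega) le_rfl).1, hP1x]; omega)
        (by rw [hqy, hR1y, (hrun1 r₁ (by omega) le_rfl).2, hP1y]; rfl))
    omega
  obtain rfl : e2 = 1 := by
    rcases he2 with h | rfl
    · exact h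
    exfalso
    have hQx := (hrun2 p₂ (by omega) le_rfl).1
    have hQy := (hrun2 p₂ (by omega) le_rfl).2
    rw [hR1x] at hQx; rw [hR1y] at hQy
    by_cases hc : p₁ + p₂ ≤ 2 * r₁
    · have h1 := hrun1 (2 * r₁ - p₂ + 1) (by omega) (by omega)
      rw [hP1x, hP1y] at h1
      have := hinj (hmem (p₂ + 1) (by omega)) (hmem (2 * r₁ - p₂ + 1) (by omega))
        (site_ext_bh (by rw [hqx, hQx, h1.1]; omega) (by rw [hqy, hQy, h1.2]; rfl))
      omega
    · have h1 := hrun2 (2 * r₁ - p₁) (by omega) (by omega)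
      rw [hR1x, hR1y] at h1
      have h2 := hR0 p₁ le_rfl
      have := hinj (hmem (2 * r₁ - p₁) (by omega)) (hmem p₁ (by omega))
        (site_ext_bh (by rw [h1.1, h2.1]; omega) (by rw [h1.2, h2.2]))
      omega
  have hQ1x : ω (p₂ + 1) 0 = p₂ - 2 := by
    rw [hqx, (hrun2 p₂ (by omega) le_rfl).1, hR1x]; omega
  have hQ1y : ω (p₂ + 1) 1 = -1 := by rw [hqy, (hrun2 p₂ (by omega) le_rfl).2, hR1y]; rfl
  have hq3 : r₁ + 3 ≤ p₂ := by rw [hQ1x, hQ1y] at hqpar; omega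
  -- run 3 on row `−1` goes right (else the second up step lands on run 2, or the run crosses `ω r₁`)
  obtain ⟨e3, he3, hrun3⟩ := run_const_velocity hinj (a := p₂ + 1) (b := r₂) (by omega) (by omega)
    (fun i hi1 hi2 => hhor' i (by omega) (by omega) (by omega) (by omega) (by omega) (by omega) (by omega))
  have hs2 : p₂ + 2 ≤ r₂ := by
    by_contra h
    obtain rfl : r₂ = p₂ + 1 := by omega
    have := hinj (hmem (p₂ + 1 + 1) (by omega)) (hmem p₂ (by omega))
      (site_ext_bh (by rw [hsx, hQ1x, (hrun2 p₂ (by omega) le_rfl).1, hR1x]; omega)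
        (by rw [hsy, hQ1y, (hrun2 p₂ (by omega) le_rfl).2, hR1y]; rfl))
    omega
  obtain rfl : e3 = 1 := by
    rcases he3 with h | rfl
    · exact h
    exfalso
    have hSx := (hrun3 r₂ (by omega) le_rfl).1
    have hSy := (hrun3 r₂ (by omega) le_rfl).2
    rw [hQ1x] at hSx; rw [hQ1y] at hSy
    have hS1 := (hb' r₂ (by omega) (by omega)).1
    by_cases hc : (r₁ : ℤ) - 1 ≤ ω r₂ 0
    · have h1 := hrun2 (2 * p₂ + 1 - r₂) (by omega) (by omega)
      rw [hR1x, hR1y] at h1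
      have := hinj (hmem (r₂ + 1) (by omega)) (hmem (2 * p₂ + 1 - r₂) (by omega))
        (site_ext_bh (by rw [hsx, hSx, h1.1]; omega) (by rw [hsy, hSy, h1.2]; rfl))
      omega
    · have h1 := hrun3 (2 * p₂ - r₁) (by omega) (by omega)
      rw [hQ1x, hQ1y] at h1
      have h2 := hrun1 r₁ (by omega) le_rfl
      rw [hP1x, hP1y] at h2
      have := hinj (hmem (2 * p₂ - r₁) (by omega)) (hmem r₁ (by omega))
        (site_ext_bh (by rw [h1.1, h2.1]; omega) (by rw [h1.2, h2.2]))
      omega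
  have hS1x : ω (r₂ + 1) 0 = r₂ - 3 := by
    rw [hsx, (hrun3 r₂ (by omega) le_rfl).1, hQ1x]; omega
  have hS1y : ω (r₂ + 1) 1 = 0 := by rw [hsy, (hrun3 r₂ (by omega) le_rfl).2, hQ1y]; rfl
  exact ⟨hrun1, hR1x, hR1y, hrev, hrun2, hq3, hQ1x, hQ1y, hrun3, hs2, hS1x, hS1y⟩

/-- **Three separate bumps (`D U D U D U`) never occur in an irreducible bridge**, of any length: the first wall return `(r₁ − 1, 0)` is a new
column maximum and every later run is pushed right of it by self-avoidance, so the next wall step `(r₁, 0)` at the even time `r₁ + 2` is a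
wall-renewal time. The proof of `dududu_false` verbatim, without its unused hypotheses `m = 6k + 2`, `visits = k`, `hYt`.
[cite: MadrasSlade1993, §4.2, Definition 4.2.1 (p. 90)] [cite: Kesten1963SAW, §4] [cite: EntingJensen2009, §7.4.2, Fig. 7.10] -/
theorem dududu_false_of_mem_ipwb {m : ℕ} (hω : ω ∈ ipwb m)
    {p₁ p₂ p₃ r₁ r₂ r₃ : ℕ} (hD : stepsD m ω = {p₁, p₂, p₃}) (hU : stepsU m ω = {r₁, r₂, r₃}) (h12 : p₁ < p₂)
    (h23 : p₂ < p₃) (hr12 : r₁ < r₂) (hr23 : r₂ < r₃) (h1 : p₁ < r₁) (h2 : p₂ < r₂) (h3 : p₃ < r₃)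
    (hp1 : 1 ≤ p₁) (hpodd : p₁ % 2 = 1) (hR0 : ∀ i, i ≤ p₁ → ω i 0 = i ∧ ω i 1 = 0)
    (hP1x : ω (p₁ + 1) 0 = p₁) (hP1y : ω (p₁ + 1) 1 = -1)
    (hhor : ∀ i, i < m → i ∉ stepsD m ω → i ∉ stepsU m ω →
      ω (i + 1) 1 = ω i 1 ∧ (ω (i + 1) 0 = ω i 0 + 1 ∨ ω (i + 1) 0 = ω i 0 - 1))
    (ho1 : r₁ < p₂) (ho2 : r₂ < p₃) : False := by
  classical
  obtain ⟨hp, hn1, hirr⟩ := mem_ipwb.1 hω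
  obtain ⟨hw, hb⟩ := mem_pwb.1 hp
  obtain ⟨ha, -⟩ := mem_wbr.1 hw
  obtain ⟨hh, -, -⟩ := mem_archs.1 ha
  obtain ⟨hs, hhp⟩ := mem_hpw.1 hh
  obtain ⟨h0, -, hbw, hinj⟩ := mem_saws_iff.1 hs
  have hX0 : ω 0 0 = 0 := by rw [h0]; rfl
  have hb' : ∀ i, 1 ≤ i → i ≤ m → 0 < ω i 0 ∧ ω i 0 ≤ ω m 0 := fun i h1 h2 => by
    have := hb i h1 h2; rwa [hX0] at this
  have hmD : ∀ i, i ∈ stepsD m ω ↔ i = p₁ ∨ i = p₂ ∨ i = p₃ := fun i => by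
    rw [hD]; simp only [Finset.mem_insert, Finset.mem_singleton]
  have hmU : ∀ i, i ∈ stepsU m ω ↔ i = r₁ ∨ i = r₂ ∨ i = r₃ := fun i => by
    rw [hU]; simp only [Finset.mem_insert, Finset.mem_singleton]
  obtain ⟨hqn, hqx, hqy, hqpar⟩ := of_mem_stepsD_coord hbw (i := p₂) ((hmD _).2 (by simp))
  obtain ⟨hq3n, hq3x, hq3y, hq3par⟩ := of_mem_stepsD_coord hbw (i := p₃) ((hmD _).2 (by simp))
  obtain ⟨hrn, hrx, hry, hrpar⟩ := of_mem_stepsU_coord hbw (i := r₁) ((hmU _).2 (by simp))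
  obtain ⟨hsn, hsx, hsy, hspar⟩ := of_mem_stepsU_coord hbw (i := r₂) ((hmU _).2 (by simp))
  obtain ⟨hr3n, hr3x, hr3y, hr3par⟩ := of_mem_stepsU_coord hbw (i := r₃) ((hmU _).2 (by simp))
  have hhor' : ∀ i, i < m → i ≠ p₁ → i ≠ p₂ → i ≠ p₃ → i ≠ r₁ → i ≠ r₂ → i ≠ r₃ →
      ω (i + 1) 1 = ω i 1 ∧ (ω (i + 1) 0 = ω i 0 + 1 ∨ ω (i + 1) 0 = ω i 0 - 1) :=
    fun i hi n1 n2 n3 n4 n5 n6 => hhor i hi (by rw [hmD]; omega) (by rw [hmU]; omega)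
  have hmem : ∀ i, i ≤ m → i ∈ {i | i ≤ m} := fun i hi => hi
  obtain ⟨hrun1, hR1x, hR1y, hrev, hrun2, hq3, hQ1x, hQ1y, hrun3, hs2, hS1x, hS1y⟩ :=
    dududu_head_of_mem_ipwb hω hD hU h12 h23 hr12 hr23 h1 h2 h3 hp1 hpodd hR0 hP1x hP1y hhor ho1 ho2
  -- run 4 on the wall goes right (else the third down step lands on run 3, or the run crosses `ω p₂`)
  obtain ⟨e4, he4, hrun4⟩ := run_const_velocity hinj (a := r₂ + 1) (b := p₃) (by omega) (by omega)
    (fun i hi1 hi2 => hhor' i (by omega) (by omega) (by omega) (by omega) (by omega) (by omega) (by omega))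
  have hq32 : r₂ + 2 ≤ p₃ := by
    by_contra h
    obtain rfl : p₃ = r₂ + 1 := by omega
    have := hinj (hmem (r₂ + 1 + 1) (by omega)) (hmem r₂ (by omega))
      (site_ext_bh (by rw [hq3x, hS1x, (hrun3 r₂ (by omega) le_rfl).1, hQ1x]; omega)
        (by rw [hq3y, hS1y, (hrun3 r₂ (by omega) le_rfl).2, hQ1y]; rfl))
    omega
  obtain rfl : e4 = 1 := by
    rcases he4 with h | rfl
    · exact h
    exfalso
    have hQx := (hrun4 p₃ (by omega) le_rfl).1
    have hQy := (hrun4 p₃ (by omega) le_rfl).2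
    rw [hS1x] at hQx; rw [hS1y] at hQy
    by_cases hc : p₂ + p₃ ≤ 2 * r₂
    · -- the third down step lands on run 3
      have h1 := hrun3 (2 * r₂ - p₃ + 1) (by omega) (by omega)
      rw [hQ1x, hQ1y] at h1
      have := hinj (hmem (p₃ + 1) (by omega)) (hmem (2 * r₂ - p₃ + 1) (by omega))
        (site_ext_bh (by rw [hq3x, hQx, h1.1]; omega) (by rw [hq3y, hQy, h1.2]; rfl))
      omega
    · -- run 4 walks over `ω p₂`
      have h1 := hrun4 (2 * r₂ - p₂) (by omega) (by omega)
      rw [hS1x, hS1y] at h1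
      have h2 := hrun2 p₂ (by omega) le_rfl
      rw [hR1x, hR1y] at h2
      have := hinj (hmem (2 * r₂ - p₂) (by omega)) (hmem p₂ (by omega))
        (site_ext_bh (by rw [h1.1, h2.1]; omega) (by rw [h1.2, h2.2]))
      omega
  have hT1x : ω (p₃ + 1) 0 = p₃ - 4 := by
    rw [hq3x, (hrun4 p₃ (by omega) le_rfl).1, hS1x]; omega
  have hT1y : ω (p₃ + 1) 1 = -1 := by rw [hq3y, (hrun4 p₃ (by omega) le_rfl).2, hS1y]; rfl
  have hq33 : r₂ + 3 ≤ p₃ := by rw [hT1x, hT1y] at hq3par; omega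
  -- run 5 on row `−1` goes right (else the last up step lands on run 4, or the run crosses `ω r₂`)
  obtain ⟨e5, he5, hrun5⟩ := run_const_velocity hinj (a := p₃ + 1) (b := r₃) (by omega) (by omega)
    (fun i hi1 hi2 => hhor' i (by omega) (by omega) (by omega) (by omega) (by omega) (by omega) (by omega))
  have hs32 : p₃ + 2 ≤ r₃ := by
    by_contra h
    obtain rfl : r₃ = p₃ + 1 := by omega
    have := hinj (hmem (p₃ + 1 + 1) (by omega)) (hmem p₃ (by omega))
      (site_ext_bh (by rw [hr3x, hT1x, (hrun4 p₃ (by omega) le_rfl).1, hS1x]; omega)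
        (by rw [hr3y, hT1y, (hrun4 p₃ (by omega) le_rfl).2, hS1y]; rfl))
    omega
  obtain rfl : e5 = 1 := by
    rcases he5 with h | rfl
    · exact h
    exfalso
    have hSx := (hrun5 r₃ (by omega) le_rfl).1
    have hSy := (hrun5 r₃ (by omega) le_rfl).2
    rw [hT1x] at hSx; rw [hT1y] at hSy
    have hS1 := (hb' r₃ (by omega) (by omega)).1
    by_cases hc : (r₂ : ℤ) - 3 ≤ ω r₃ 0
    · -- the last up step lands on run 4
      have h1 := hrun4 (2 * p₃ + 1 - r₃) (by omega) (by omega)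
      rw [hS1x, hS1y] at h1
      have := hinj (hmem (r₃ + 1) (by omega)) (hmem (2 * p₃ + 1 - r₃) (by omega))
        (site_ext_bh (by rw [hr3x, hSx, h1.1]; omega) (by rw [hr3y, hSy, h1.2]; rfl))
      omega
    · -- run 5 walks over `ω r₂`
      have h1 := hrun5 (2 * p₃ - r₂) (by omega) (by omega)
      rw [hT1x, hT1y] at h1
      have h2 := hrun3 r₂ (by omega) le_rfl
      rw [hQ1x, hQ1y] at h2
      have := hinj (hmem (2 * p₃ - r₂) (by omega)) (hmem r₂ (by omega))
        (site_ext_bh (by rw [h1.1, h2.1]; omega) (by rw [h1.2, h2.2]))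
      omega
  have hU1x : ω (r₃ + 1) 0 = r₃ - 5 := by
    rw [hr3x, (hrun5 r₃ (by omega) le_rfl).1, hT1x]; omega
  have hU1y : ω (r₃ + 1) 1 = 0 := by rw [hr3y, (hrun5 r₃ (by omega) le_rfl).2, hT1y]; rfl
  -- run 6 on the wall stays right of column `r₃ − 5`
  obtain ⟨e6, he6, hrun6⟩ := run_const_velocity hinj (a := r₃ + 1) (b := m) (by omega) le_rfl
    (fun i hi1 hi2 => hhor' i (by omega) (by omega) (by omega) (by omega) (by omega) (by omega) (by omega))
  have hR6 : ∀ j, r₃ + 1 ≤ j → j ≤ m → (r₃ : ℤ) - 5 ≤ ω j 0 := by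
    intro j hj1 hj2
    have hj := (hrun6 j hj1 hj2).1
    have hN := (hrun6 m (by omega) le_rfl).1
    have hbn := (hb' (r₃ + 1) (by omega) (by omega)).2
    rw [hU1x] at hj hN hbn
    rcases he6 with rfl | rfl <;> omega
  -- the wall site `(r₁, 0)` at time `r₁ + 2` is a wall-renewal time
  have hXr2 : ω (r₁ + 2) 0 = r₁ := by
    have := (hrun2 (r₁ + 2) (by omega) (by omega)).1; rw [hR1x] at this; rw [this]; omega
  refine hirr (r₁ + 2) (by omega) (by omega) (isWRen_of_profile hb (by omega) (by omega) ?_ ?_ ?_)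
  · rw [(hrun2 (r₁ + 2) (by omega) (by omega)).2, hR1y]
  · intro i hi1 hi2
    rw [hXr2]
    rcases Nat.lt_or_ge i (p₁ + 1) with hi | hi
    · have := (hR0 i (by omega)).1; omega
    rcases Nat.lt_or_ge i (r₁ + 1) with hi' | hi'
    · have := (hrun1 i hi (by omega)).1; rw [hP1x] at this; omega
    · have := (hrun2 i hi' (by omega)).1; rw [hR1x] at this; omega
  · intro j hj1 hj2
    rw [hXr2]
    rcases Nat.lt_or_ge j (p₂ + 1) with hj | hj
    · have := (hrun2 j (by omega) (by omega)).1; rw [hR1x] at this; omega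
    rcases Nat.lt_or_ge j (r₂ + 1) with hja | hja
    · have := (hrun3 j hj (by omega)).1; rw [hQ1x] at this; omega
    rcases Nat.lt_or_ge j (p₃ + 1) with hjb | hjb
    · have := (hrun4 j hja (by omega)).1; rw [hS1x] at this; omega
    rcases Nat.lt_or_ge j (r₃ + 1) with hjc | hjc
    · have := (hrun5 j hjb (by omega)).1; rw [hT1x] at this; omega
    · have := hR6 j hjc hj2; omega

/-! ### §5  The order `D D U U D U` never occurs (any length)

At slack two `dduudu_false` used the slack-two counts. The order is in fact impossible in an irreducible bridge of ANY length, by a renewal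
argument: the interior wall run goes right (a left run strands the final wall run left of the first wall return), the bump after it goes
right, and the depth-two excursion stays left of the dive column `c'` of the bump (its row-`−1` runs cannot pass the sites `(c, −1)`,
`(c', −1)` of the later vertical steps); so the wall site `(c' − 1, 0)` one step before that dive, at the even time `p₃ − 1`, is a
wall-renewal time. -/

/-- The renewal step of `dduudu_false_of_mem_ipwb`, isolated: once the six runs of a `D D U U D U` block are straight with the interior
wall run, the bump and the final run going right, the excursion left of the bump's dive column `c'` and the first wall return right of
the initial run, the wall site `(c' − 1, 0)` at the even time `p₃ − 1` is a wall-renewal time — impossible inside an irreducible bridge.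
[cite: MadrasSlade1993, §4.2, Definition 4.2.1 and the remark before (4.2.21); EntingJensen2009, §7.4.2, Fig. 7.10] -/
theorem dduudu_renewal_false {m : ℕ} (hω : ω ∈ ipwb m) {p₁ p₂ p₃ r₁ r₂ r₃ : ℕ} {e1 e2 e3 : ℤ}
    (h12 : p₁ < p₂) (ho1 : p₂ < r₁) (hr12 : r₁ < r₂) (hWlen : r₂ + 2 ≤ p₃) (hUlen : p₃ + 2 ≤ r₃) (hr3n : r₃ < m)
    (hp3odd : p₃ % 2 = 1) (hR0 : ∀ i, i ≤ p₁ → ω i 0 = i ∧ ω i 1 = 0) (hP1x : ω (p₁ + 1) 0 = p₁) (he1 : e1 = 1 ∨ e1 = -1)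
    (hrun1 : ∀ i, p₁ + 1 ≤ i → i ≤ p₂ → ω i 0 = ω (p₁ + 1) 0 + e1 * ((i - (p₁ + 1) : ℕ) : ℤ) ∧ ω i 1 = ω (p₁ + 1) 1)
    (ha : ω p₂ 0 = p₁ + e1 * ((p₂ - (p₁ + 1) : ℕ) : ℤ)) (hqx : ω (p₂ + 1) 0 = ω p₂ 0) (he2 : e2 = 1 ∨ e2 = -1)
    (hrun2 : ∀ i, p₂ + 1 ≤ i → i ≤ r₁ → ω i 0 = ω (p₂ + 1) 0 + e2 * ((i - (p₂ + 1) : ℕ) : ℤ) ∧ ω i 1 = ω (p₂ + 1) 1)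
    (hbcol : ω r₁ 0 = ω p₂ 0 + e2 * ((r₁ - (p₂ + 1) : ℕ) : ℤ)) (hrx : ω (r₁ + 1) 0 = ω r₁ 0) (he3 : e3 = 1 ∨ e3 = -1)
    (hrun3 : ∀ i, r₁ + 1 ≤ i → i ≤ r₂ → ω i 0 = ω (r₁ + 1) 0 + e3 * ((i - (r₁ + 1) : ℕ) : ℤ) ∧ ω i 1 = ω (r₁ + 1) 1)
    (hccol : ω r₂ 0 = ω r₁ 0 + e3 * ((r₂ - (r₁ + 1) : ℕ) : ℤ)) (hsx : ω (r₂ + 1) 0 = ω r₂ 0) (hW1y : ω (r₂ + 1) 1 = 0)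
    (hrunW : ∀ i, r₂ + 1 ≤ i → i ≤ p₃ → ω i 0 = ω (r₂ + 1) 0 + 1 * ((i - (r₂ + 1) : ℕ) : ℤ) ∧ ω i 1 = ω (r₂ + 1) 1)
    (hcW : ω p₃ 0 = ω r₂ 0 + 1 * ((p₃ - (r₂ + 1) : ℕ) : ℤ)) (hq3x : ω (p₃ + 1) 0 = ω p₃ 0)
    (hrun5 : ∀ i, p₃ + 1 ≤ i → i ≤ r₃ → ω i 0 = ω (p₃ + 1) 0 + 1 * ((i - (p₃ + 1) : ℕ) : ℤ) ∧ ω i 1 = ω (p₃ + 1) 1)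
    (hx6 : ω r₃ 0 = ω p₃ 0 + 1 * ((r₃ - (p₃ + 1) : ℕ) : ℤ)) (hr3x : ω (r₃ + 1) 0 = ω r₃ 0)
    (hrun6 : ∀ i, r₃ + 1 ≤ i → i ≤ m → ω i 0 = ω (r₃ + 1) 0 + 1 * ((i - (r₃ + 1) : ℕ) : ℤ) ∧ ω i 1 = ω (r₃ + 1) 1)
    (hx4p : (p₁ : ℤ) + 1 ≤ ω r₂ 0) (hbc : ω r₁ 0 < ω p₃ 0) (hac : ω p₂ 0 < ω p₃ 0) : False := by
  obtain ⟨hp, hn1, hirr⟩ := mem_ipwb.1 hω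
  obtain ⟨hw, hb⟩ := mem_pwb.1 hp
  have hXT : ω (p₃ - 1) 0 = ω p₃ 0 - 1 := by
    have := (hrunW (p₃ - 1) (by omega) (by omega)).1; rw [hsx] at this; rw [this, hcW]; omega
  refine hirr (p₃ - 1) (by omega) (by omega) (isWRen_of_profile hb (by omega) (by omega) ?_ ?_ ?_)
  · rw [(hrunW (p₃ - 1) (by omega) (by omega)).2, hW1y]
  · intro i hi1 hi2
    rw [hXT]
    rcases Nat.lt_or_ge i (p₁ + 1) with hi | hi
    · have := (hR0 i (by omega)).1; omega
    rcases Nat.lt_or_ge i (p₂ + 1) with hia | hia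
    · have := (hrun1 i hi (by omega)).1; rw [hP1x] at this; rcases he1 with rfl | rfl <;> omega
    rcases Nat.lt_or_ge i (r₁ + 1) with hib | hib
    · have := (hrun2 i hia (by omega)).1; rw [hqx] at this; rcases he2 with rfl | rfl <;> omega
    rcases Nat.lt_or_ge i (r₂ + 1) with hic | hic
    · have := (hrun3 i hib (by omega)).1; rw [hrx] at this; rcases he3 with rfl | rfl <;> omega
    · have := (hrunW i hic (by omega)).1; rw [hsx] at this; omega
  · intro j hj1 hj2
    rw [hXT]
    rcases Nat.lt_or_ge j (p₃ + 1) with hj | hj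
    · obtain rfl : j = p₃ := by omega
      omega
    rcases Nat.lt_or_ge j (r₃ + 1) with hja | hja
    · have := (hrun5 j hj (by omega)).1; rw [hq3x] at this; omega
    · have := (hrun6 j hja hj2).1; rw [hr3x, hx6] at this; omega

/-- **A depth-two excursion followed by a bump (`D D U U D U`) never occurs in an irreducible bridge**, of any length (see the section
docstring: the wall site one step before the bump's dive is a wall-renewal time). OURS; supersedes the slack-two `dduudu_false` for the
classifications at every slack. [cite: MadrasSlade1993, §4.2, Definition 4.2.1 (p. 90)] [cite: Kesten1963SAW, §4] [cite: EntingJensen2009, §7.4.2, Fig. 7.10] -/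
theorem dduudu_false_of_mem_ipwb {m : ℕ} (hω : ω ∈ ipwb m)
    {p₁ p₂ p₃ r₁ r₂ r₃ : ℕ} (hD : stepsD m ω = {p₁, p₂, p₃}) (hU : stepsU m ω = {r₁, r₂, r₃}) (h12 : p₁ < p₂)
    (h23 : p₂ < p₃) (hr12 : r₁ < r₂) (hr23 : r₂ < r₃) (h1 : p₁ < r₁) (h2 : p₂ < r₂) (h3 : p₃ < r₃)
    (hp1 : 1 ≤ p₁) (hpodd : p₁ % 2 = 1) (hR0 : ∀ i, i ≤ p₁ → ω i 0 = i ∧ ω i 1 = 0)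
    (hP1y : ω (p₁ + 1) 1 = -1)
    (hhor : ∀ i, i < m → i ∉ stepsD m ω → i ∉ stepsU m ω →
      ω (i + 1) 1 = ω i 1 ∧ (ω (i + 1) 0 = ω i 0 + 1 ∨ ω (i + 1) 0 = ω i 0 - 1))
    (ho1 : p₂ < r₁) (ho2 : r₂ < p₃) : False := by
  classical
  obtain ⟨hp, hn1, hirr⟩ := mem_ipwb.1 hω
  obtain ⟨hw, hb⟩ := mem_pwb.1 hp
  obtain ⟨ha, -⟩ := mem_wbr.1 hw
  obtain ⟨hh, hn2, -⟩ := mem_archs.1 ha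
  obtain ⟨hs, hhp⟩ := mem_hpw.1 hh
  obtain ⟨h0, -, hbw, hinj⟩ := mem_saws_iff.1 hs
  have hX0 : ω 0 0 = 0 := by rw [h0]; rfl
  have hb' : ∀ i, 1 ≤ i → i ≤ m → 0 < ω i 0 ∧ ω i 0 ≤ ω m 0 := fun i h1 h2 => by
    have := hb i h1 h2; rwa [hX0] at this
  have hmD : ∀ i, i ∈ stepsD m ω ↔ i = p₁ ∨ i = p₂ ∨ i = p₃ := fun i => by
    rw [hD]; simp only [Finset.mem_insert, Finset.mem_singleton]
  have hmU : ∀ i, i ∈ stepsU m ω ↔ i = r₁ ∨ i = r₂ ∨ i = r₃ := fun i => by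
    rw [hU]; simp only [Finset.mem_insert, Finset.mem_singleton]
  obtain ⟨hpn, hpx1, hpy1, -⟩ := of_mem_stepsD_coord hbw (i := p₁) ((hmD _).2 (by simp))
  obtain ⟨hqn, hqx, hqy, hqpar⟩ := of_mem_stepsD_coord hbw (i := p₂) ((hmD _).2 (by simp))
  obtain ⟨hq3n, hq3x, hq3y, hq3par⟩ := of_mem_stepsD_coord hbw (i := p₃) ((hmD _).2 (by simp))
  obtain ⟨hrn, hrx, hry, hrpar⟩ := of_mem_stepsU_coord hbw (i := r₁) ((hmU _).2 (by simp))
  obtain ⟨hsn, hsx, hsy, hspar⟩ := of_mem_stepsU_coord hbw (i := r₂) ((hmU _).2 (by simp))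
  obtain ⟨hr3n, hr3x, hr3y, hr3par⟩ := of_mem_stepsU_coord hbw (i := r₃) ((hmU _).2 (by simp))
  have hhor' : ∀ i, i < m → i ≠ p₁ → i ≠ p₂ → i ≠ p₃ → i ≠ r₁ → i ≠ r₂ → i ≠ r₃ →
      ω (i + 1) 1 = ω i 1 ∧ (ω (i + 1) 0 = ω i 0 + 1 ∨ ω (i + 1) 0 = ω i 0 - 1) :=
    fun i hi n1 n2 n3 n4 n5 n6 => hhor i hi (by rw [hmD]; omega) (by rw [hmU]; omega)
  have hmem : ∀ i, i ≤ m → i ∈ {i | i ≤ m} := fun i hi => hi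
  have hP1x : ω (p₁ + 1) 0 = p₁ := by rw [hpx1, (hR0 p₁ le_rfl).1]
  -- the runs: rows `−1, −2, −1`, the interior wall run `r₂ + 1 … p₃`, row `−1` until `r₃`, then the wall
  obtain ⟨e1, he1, hrun1⟩ := run_const_velocity hinj (a := p₁ + 1) (b := p₂) (by omega) (by omega)
    (fun i hi1 hi2 => hhor' i (by omega) (by omega) (by omega) (by omega) (by omega) (by omega) (by omega))
  have hQ1y : ω (p₂ + 1) 1 = -2 := by rw [hqy, (hrun1 p₂ (by omega) le_rfl).2, hP1y]; rfl
  have ha : ω p₂ 0 = p₁ + e1 * ((p₂ - (p₁ + 1) : ℕ) : ℤ) := by rw [(hrun1 p₂ (by omega) le_rfl).1, hP1x]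
  obtain ⟨e2, he2, hrun2⟩ := run_const_velocity hinj (a := p₂ + 1) (b := r₁) (by omega) (by omega)
    (fun i hi1 hi2 => hhor' i (by omega) (by omega) (by omega) (by omega) (by omega) (by omega) (by omega))
  have hC1y : ω (r₁ + 1) 1 = -1 := by rw [hry, (hrun2 r₁ (by omega) le_rfl).2, hQ1y]; rfl
  have hbcol : ω r₁ 0 = ω p₂ 0 + e2 * ((r₁ - (p₂ + 1) : ℕ) : ℤ) := by rw [(hrun2 r₁ (by omega) le_rfl).1, hqx]
  obtain ⟨e3, he3, hrun3⟩ := run_const_velocity hinj (a := r₁ + 1) (b := r₂) (by omega) (by omega)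
    (fun i hi1 hi2 => hhor' i (by omega) (by omega) (by omega) (by omega) (by omega) (by omega) (by omega))
  have hSy : ω r₂ 1 = -1 := by rw [(hrun3 r₂ (by omega) le_rfl).2, hC1y]
  have hccol : ω r₂ 0 = ω r₁ 0 + e3 * ((r₂ - (r₁ + 1) : ℕ) : ℤ) := by rw [(hrun3 r₂ (by omega) le_rfl).1, hrx]
  have hW1y : ω (r₂ + 1) 1 = 0 := by rw [hsy, hSy]; rfl
  obtain ⟨ε, hε, hrunW⟩ := run_const_velocity hinj (a := r₂ + 1) (b := p₃) (by omega) (by omega)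
    (fun i hi1 hi2 => hhor' i (by omega) (by omega) (by omega) (by omega) (by omega) (by omega) (by omega))
  have hTy : ω p₃ 1 = 0 := by rw [(hrunW p₃ (by omega) le_rfl).2, hW1y]
  have hT1y : ω (p₃ + 1) 1 = -1 := by rw [hq3y, hTy]; rfl
  have hcW : ω p₃ 0 = ω r₂ 0 + ε * ((p₃ - (r₂ + 1) : ℕ) : ℤ) := by rw [(hrunW p₃ (by omega) le_rfl).1, hsx]
  have hp3odd : p₃ % 2 = 1 := by
    have := parity_apply hs (show p₃ + 1 ≤ m by omega); rw [hq3x, hT1y] at this; omega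
  obtain ⟨e5, he5, hrun5⟩ := run_const_velocity hinj (a := p₃ + 1) (b := r₃) (by omega) (by omega)
    (fun i hi1 hi2 => hhor' i (by omega) (by omega) (by omega) (by omega) (by omega) (by omega) (by omega))
  have hUy : ω r₃ 1 = -1 := by rw [(hrun5 r₃ (by omega) le_rfl).2, hT1y]
  have hU1y : ω (r₃ + 1) 1 = 0 := by rw [hr3y, hUy]; rfl
  have hr3ev : r₃ % 2 = 0 := by have := parity_apply hs (show r₃ ≤ m by omega); rw [hUy] at this; omega
  have hx6 : ω r₃ 0 = ω p₃ 0 + e5 * ((r₃ - (p₃ + 1) : ℕ) : ℤ) := by rw [(hrun5 r₃ (by omega) le_rfl).1, hq3x]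
  obtain ⟨e6, he6, hrun6⟩ := run_const_velocity hinj (a := r₃ + 1) (b := m) (by omega) le_rfl
    (fun i hi1 hi2 => hhor' i (by omega) (by omega) (by omega) (by omega) (by omega) (by omega) (by omega))
  obtain rfl : e6 = 1 := by
    rcases he6 with h | rfl
    · exact h
    exfalso
    have hN := (hrun6 m (by omega) le_rfl).1
    have hbn := (hb' (r₃ + 1) (by omega) (by omega)).2
    omega
  have hN := (hrun6 m (by omega) le_rfl).1
  -- (1) the interior wall run and the bump are proper: `p₃ ≥ r₂ + 2`, `r₃ ≥ p₃ + 2`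
  have hWlen : r₂ + 2 ≤ p₃ := by
    by_contra hlt
    obtain rfl : p₃ = r₂ + 1 := by omega
    have := hinj (hmem (r₂ + 1 + 1) (by omega)) (hmem r₂ (by omega))
      (site_ext_bh (by rw [hq3x, hsx]) (by rw [hT1y, hSy]))
    omega
  -- (2) the first wall return `c = ω r₂ 0` is right of the initial run; the last one is right of `c`
  have hx4p : (p₁ : ℤ) + 1 ≤ ω r₂ 0 := by
    by_contra hlt
    have hs1 := (hb' r₂ (by omega) (by omega)).1
    have hτ := hR0 (ω r₂ 0).toNat (by omega)
    have := hinj (hmem (r₂ + 1) (by omega)) (hmem (ω r₂ 0).toNat (by omega))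
      (site_ext_bh (by rw [hsx, hτ.1]; omega) (by rw [hW1y, hτ.2]))
    omega
  have hx64 : ω r₂ 0 < ω r₃ 0 := by
    by_contra hle
    have hbm := (hb' (r₂ + 1) (by omega) (by omega)).2
    have h1 := hrun6 (r₃ + 1 + ((ω r₂ 0).toNat - (ω r₃ 0).toNat)) (by omega) (by omega)
    rw [hr3x, hU1y] at h1
    have hpos := (hb' r₃ (by omega) (by omega)).1
    have := hinj (hmem (r₃ + 1 + ((ω r₂ 0).toNat - (ω r₃ 0).toNat)) (by omega)) (hmem (r₂ + 1) (by omega))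
      (site_ext_bh (by rw [h1.1, hsx]; omega) (by rw [h1.2, hW1y]))
    omega
  -- (3) the interior wall run goes right (else the bump's row-`−1` run passes the site `ω r₂ = (c, −1)`)
  obtain rfl : ε = 1 := by
    rcases hε with h | rfl
    · exact h
    exfalso
    obtain rfl : e5 = 1 := by
      rcases he5 with h | rfl
      · exact h
      · exfalso; omega
    have h1 := hrun5 (p₃ + 1 + (p₃ - r₂ - 1)) (by omega) (by omega)
    rw [hq3x, hT1y] at h1
    have := hinj (hmem (p₃ + 1 + (p₃ - r₂ - 1)) (by omega)) (hmem r₂ (by omega))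
      (site_ext_bh (by rw [h1.1, hcW]; omega) (by rw [h1.2, hSy]))
    omega
  have hUlen : p₃ + 2 ≤ r₃ := by
    by_contra hlt
    obtain rfl : r₃ = p₃ + 1 := by omega
    have := hinj (hmem (p₃ + 1 + 1) (by omega)) (hmem p₃ (by omega))
      (site_ext_bh (by rw [hr3x, hq3x]) (by rw [hU1y, hTy]))
    omega
  -- (4) the bump goes right (else its wall return lands on the interior wall run)
  obtain rfl : e5 = 1 := by
    rcases he5 with h | rfl
    · exact h
    exfalso
    have h1 := hrunW (2 * p₃ + 1 - r₃) (by omega) (by omega)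
    rw [hsx, hW1y] at h1
    have := hinj (hmem (r₃ + 1) (by omega)) (hmem (2 * p₃ + 1 - r₃) (by omega))
      (site_ext_bh (by rw [hr3x, hx6, hcW, h1.1]; omega) (by rw [hU1y, h1.2]))
    omega
  -- (5) the excursion stays left of the bump's dive column `c' = ω p₃ 0`
  have hbc : ω r₁ 0 < ω p₃ 0 := by
    by_contra hle
    obtain rfl : e3 = -1 := by
      rcases he3 with rfl | h
      · exfalso; omega
      · exact h
    have h1 := hrun3 (r₁ + 1 + ((ω r₁ 0).toNat - (ω p₃ 0).toNat)) (by omega) (by omega)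
    rw [hrx, hC1y] at h1
    have hpos := (hb' p₃ (by omega) (by omega)).1
    have hpos' := (hb' r₁ (by omega) (by omega)).1
    have := hinj (hmem (r₁ + 1 + ((ω r₁ 0).toNat - (ω p₃ 0).toNat)) (by omega)) (hmem (p₃ + 1) (by omega))
      (site_ext_bh (by rw [h1.1, hq3x]; omega) (by rw [h1.2, hT1y]))
    omega
  have hac : ω p₂ 0 < ω p₃ 0 := by
    by_contra hle
    obtain rfl : e1 = 1 := by
      rcases he1 with h | rfl
      · exact h
      · exfalso; omega
    have h1 := hrun1 (p₁ + 1 + ((ω r₂ 0).toNat - p₁)) (by omega) (by omega)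
    rw [hP1x, hP1y] at h1
    have := hinj (hmem (p₁ + 1 + ((ω r₂ 0).toNat - p₁)) (by omega)) (hmem r₂ (by omega))
      (site_ext_bh (by rw [h1.1]; omega) (by rw [h1.2, hSy]))
    omega
  -- (6) the wall site `(c' − 1, 0)` at the even time `p₃ − 1` is a wall-renewal time
  exact dduudu_renewal_false hω h12 ho1 hr12 hWlen hUlen hr3n hp3odd hR0 hP1x he1 hrun1 ha hqx he2 hrun2 hbcol hrx he3
    hrun3 hccol hsx hW1y hrunW hcW hq3x hrun5 hx6 hr3x hrun6 hx4p hbc hac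

/-! ### §6  Dispatcher: three down steps at slack four, orders other than `D D D U U U` -/

/-- **Three down steps at slack four, mixed orders.** For an irreducible positive wall bridge of length `6k + 4` with `k ≥ 2` visits and three
down steps NOT in the order `D D D U U U` (`r₁ < p₃`): of the four remaining orders, `D U D U D U` and `D D U U D U` never occur
(`dududu_false_of_mem_ipwb`, `dduudu_false_of_mem_ipwb`), `D U D D U U` is the single block `g3b k` (`dudduu_slack_four`), and
`D D U D U U` is left to the successor car — so either the order is `D D U D U U`, or the walk is `g3b k`. OURS.
[cite: MadrasSlade1993, §4.2, Definition 4.2.1 (p. 90) and remark before (4.2.21) (p. 94)] [cite: EntingJensen2009, §7.4.2, Fig. 7.10] -/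
theorem three_down_mixed_slack_four {k m : ℕ} (hk : 2 ≤ k) (hm : m = 6 * k + 4) (hω : ω ∈ ipwb m) (hv : visits m ω = k)
    {p₁ p₂ p₃ r₁ r₂ r₃ : ℕ} (hD : stepsD m ω = {p₁, p₂, p₃}) (hU : stepsU m ω = {r₁, r₂, r₃}) (h12 : p₁ < p₂)
    (h23 : p₂ < p₃) (hr12 : r₁ < r₂) (hr23 : r₂ < r₃) (h1 : p₁ < r₁) (h2 : p₂ < r₂) (h3 : p₃ < r₃)
    (hp1 : 1 ≤ p₁) (hpodd : p₁ % 2 = 1) (hR0 : ∀ i, i ≤ p₁ → ω i 0 = i ∧ ω i 1 = 0)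
    (hP1x : ω (p₁ + 1) 0 = p₁) (hP1y : ω (p₁ + 1) 1 = -1)
    (hhor : ∀ i, i < m → i ∉ stepsD m ω → i ∉ stepsU m ω →
      ω (i + 1) 1 = ω i 1 ∧ (ω (i + 1) 0 = ω i 0 + 1 ∨ ω (i + 1) 0 = ω i 0 - 1))
    (hmix : r₁ < p₃) :
    (p₂ < r₁ ∧ r₁ < p₃ ∧ p₃ < r₂) ∨ (r₁ < p₂ ∧ p₃ < r₂ ∧ p₁ = 1 ∧ r₁ = 4 ∧ p₂ = 2 * k + 3 ∧ p₃ = 4 * k + 1 ∧ r₂ = 6 * k ∧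
      r₃ = 6 * k + 2 ∧ ω = g3b k) := by
  classical
  obtain ⟨hpw, -, -⟩ := mem_ipwb.1 hω
  obtain ⟨-, -, hbw, -⟩ := mem_saws_iff.1 (saws_of_mem_pwb hpw)
  obtain ⟨-, -, hpy2, -⟩ := of_mem_stepsD_coord hbw (i := p₂) (by rw [hD]; simp)
  obtain ⟨-, -, hpy3, -⟩ := of_mem_stepsD_coord hbw (i := p₃) (by rw [hD]; simp)
  obtain ⟨-, -, hry1, -⟩ := of_mem_stepsU_coord hbw (i := r₁) (by rw [hU]; simp)
  obtain ⟨-, -, hry2, -⟩ := of_mem_stepsU_coord hbw (i := r₂) (by rw [hU]; simp)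
  have hne : ∀ {a b : ℕ}, ω (a + 1) 1 = ω a 1 - 1 → ω (b + 1) 1 = ω b 1 + 1 → a ≠ b := by
    intro a b ha hb h; rw [h] at ha; omega
  have n21 := hne hpy2 hry1
  have n32 := hne hpy3 hry2
  rcases Nat.lt_or_gt_of_ne n21 with h21 | h21
  · -- `p₂ < r₁ < p₃`
    rcases Nat.lt_or_gt_of_ne n32 with h32 | h32
    · exact Or.inl ⟨h21, hmix, h32⟩
    · exact (dduudu_false_of_mem_ipwb hω hD hU h12 h23 hr12 hr23 h1 h2 h3 hp1 hpodd hR0 hP1y hhor h21 h32).elim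
  · -- `r₁ < p₂`
    rcases Nat.lt_or_gt_of_ne n32 with h32 | h32
    · exact Or.inr ⟨h21, h32, dudduu_slack_four hk hm hω hv hD hU h12 h23 hr12 hr23 h1 h3 hp1 hpodd hR0 hP1x hP1y
        hhor h21 h32⟩
    · exact (dududu_false_of_mem_ipwb hω hD hU h12 h23 hr12 hr23 h1 h2 h3 hp1 hpodd hR0 hP1x hP1y hhor h21 h32).elim

end Literature.Probability.RandomPlanarGeometry.SAW.HexBW.Wall
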